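import Literature.Computability.AlgebraicComplexity.BD17GaleSolutionCorrespondence
import Literature.Computability.AlgebraicComplexity.BD17DescartesSystemsWronskians
import Mathlib.RingTheory.Henselian
import Mathlib.RingTheory.AdjoinRoot
import Mathlib.LinearAlgebra.Matrix.Nondegenerate
import Mathlib.Algebra.Ring.GeomSum
import HarnessLib

/-!
# Bihan–Dickenstein 2017, §4.2: the Gale correspondence PRESERVES MULTIPLICITIES ([BS08]) — PROVED

F. Bihan, A. Dickenstein, *Descartes' rule of signs for polynomial systems supported on circuits*,
Int. Math. Res. Not. IMRN 2017 (22) 6867–6893 = arXiv:1601.05826 [BihanDickenstein2017], §4.2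
(held text `paper:arxiv-1601.05826`, p0011:L22–L60: the normalized Gale basis `P^j, P^i`, the
equations (4.3), the function `g(y) = ∏ p_ℓ(y)^{λ̃_ℓ}` (4.4) and the sentence "this bijection
`x ↦ y = x^{w_{ᾱ_j}}` between positive solutions of (1.1) and solutions of `g(y) = 1` in `Δ_P`
preserves the multiplicities [BS08]", p0011:L56–57), together with its source
F. Bihan, F. Sottile, *Gale duality for complete intersections*, Ann. Inst. Fourier 58 (2008)
877–891 = arXiv:0706.3745 [BihanSottile2008], Thm. 2.2 (held text `paper:arxiv-0706.3745`,
p0006:L71 "Theorem 5": "The system of polynomials … and the system of master functions … define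
isomorphic complete intersections", proof p0006:L76–85 via the linear forms
`Λ_i(z) = z_i − p_i(z)`) and §3 (p0007:L10–18: "Gale duality also holds for `ℝ₊`").
THEOREMS (and definitions with bodies) ONLY — no named facts; sibling of the statement file
`BD17DescartesCircuits.lean` (cell `val-lit`, row X4-BD17), supplying the one ingredient of the proof
of its Thm. 2.9 / Prop. 2.12 that the tree lacked (cf. `BD17GaleSolutionCorrespondence.lean`, the
SET-THEORETIC half): the LOCAL, multiplicity-level form of Gale duality at a positive solution.

## Main result

`BD17.solMultiplicity_eq_rootMultiplicity`: for a circuit `𝒜 = {w_ℓ}` with `rk A = n + 1`,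
`rk C = n` (1.3), two indices `a ≠ b` with `det C(a, b) ≠ 0`, the normalized kernel basis `B` of
`C` (`P_a = (1, 0)`, `P_b = (0, 1)`, `BD17.IsNormalizedGaleBasis`), an integer affine relation `μ`
(`A μ = 0`, `μ_b ≠ 0`; the print uses `λ̃`, the corollary `…_affRel` uses `λ`) and a positive
solution `x` of (1.1):

  `BD17.solMultiplicity w C x = rootMultiplicity (x^{w_b − w_a}) (∏_{μ_ℓ>0} p_ℓ^{μ_ℓ} − ∏_{μ_ℓ<0} p_ℓ^{−μ_ℓ})`

whenever that polynomial (`BD17.galePoly B μ`; `p_ℓ = P_{ℓ,1} + P_{ℓ,2} Y`, `BD17.linPoly`) is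
nonzero — i.e. the intersection multiplicity `dim_ℝ ℝ[X]_{𝔪_x}/(f_1, …, f_n)` of the statement
file equals the multiplicity of the corresponding root `y₀ = x^{w_b − w_a} ∈ Δ_P` of `g − 1`
(cleared of denominators).

## Proof (algebraic; [BS08] Thm. 2.2 made local and explicit)

Write `O = ℝ[X]_{𝔪_x}`, `J = (f) O`, `D = ℝ[Y]/((Y − y₀)^m)`, `m` the root multiplicity.
* In `O` the `X_k` are units, so Laurent monomials `X^u`, `u ∈ ℤ^n`, make sense (`BD17.umon`,
  `BD17.locMon`); `J` is generated by `h_ℓ = X^{w_ℓ} − P_{ℓ,1} X^{w_a} − P_{ℓ,2} X^{w_b}` (the forms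
  `Λ_i` of [BS08]: `f = C_S · h` with `C_S = C(a,b)` invertible; `BD17.hgen_mem_map_systemIdeal`,
  `BD17.map_systemIdeal_le_ker`).
* `Φ : D → O/J`, `Y ↦ X^{v}`, `v = w_b − w_a` (`GaleLocalData.phi`): modulo `J`,
  `p_ℓ(X^v) = X^{w_ℓ − w_a}`, so `∏ p_ℓ(X^v)^{μ⁺} − ∏ p_ℓ(X^v)^{μ⁻} = X^{∑⁺} − X^{∑⁻} = 0` by the
  affine relation; as `G = (Y − y₀)^m H` with `H(y₀) ≠ 0` and `H(X^v)` is a unit of the local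
  algebra (units are detected by evaluation at `x`, `GaleLocalData.quotEval`), `(Y − y₀)^m ↦ 0`.
* `Ψ : O/J → D`, `X_k ↦ ρ_k` (`GaleLocalData.psi`): with `U = (w_{e_t} − w_a)_t` (nonsingular for a
  circuit, `BD17.det_expDiff_ne_zero`), `N = det(U)²` and the adjugate coefficients
  `∑_t c_{k,t} u_t = N e_k` (`BD17.sum_adjCoef_smul`), `ρ_k` is the Hensel `N`-th root of
  `q̄_k = ∏_t p̄_{e_t}^{c_{k,t}}` with residue `x_k` in the (trivially complete, hence Henselian)
  Artinian ring `D` (`BD17.exists_pow_eq_of_truncRes`). Then `ρ^{u_t} = p̄_{e_t}` (both are `N`-th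
  roots of `p̄_{e_t}^N` with residue `x^{u_t}`; two `N`-th roots with the same nonzero residue
  coincide, `BD17.eq_of_pow_eq_pow_of_residue`) and `ρ^{v} = Ȳ` (same argument, using `μ_b ≠ 0`,
  `∑_ℓ μ_ℓ u_ℓ = 0` and `∏ p̄_ℓ^{μ_ℓ} = 1` in `D`), so `Ψ` kills the `h_ℓ`.
* `Ψ ∘ Φ = id` on `Ȳ`; `Φ ∘ Ψ = id` on the `X_k` by the same `N`-th-root argument in `O/J`;
  hence `O/J ≃ₐ D` (`GaleLocalData.localAlgEquiv`) and `dim_ℝ O/J = m` (`BD17.finrank_trunc`).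

Deviation from print: the sources argue globally (scheme isomorphism for primitive `𝒜`, and an
odd-index / positivity remark for `ℝ₊`); here the statement is proved directly at one positive
point, for any circuit (the index of `ℤ𝒜` is absorbed by the `N`-th roots, which exist at positive
points), which is exactly what BD 2017 §4.2 uses.

Honest framing: a typed-literature companion (LADDER-VALIANT V1 ideation source, cell `val-lit`);
nothing here bears on VP versus VNP. What remains of X4-BD17 by name: Thm. 2.9 and Prop. 2.12
(this file + Rolle + Prop. 4.3 + Lemma 4.4, all in the tree, remain to be assembled), Thm. 5.1.

## References

* [BihanDickenstein2017] F. Bihan, A. Dickenstein, IMRN 2017 (22) 6867–6893; arXiv:1601.05826, §4.2.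
* [BihanSottile2008] F. Bihan, F. Sottile, *Gale duality for complete intersections*, Ann. Inst.
  Fourier 58 (2008) 877–891; arXiv:0706.3745, Thm. 2.2, §3.
-/

noncomputable section

open Matrix Finset Polynomial

namespace Literature.Computability.AlgebraicComplexity

namespace BD17

/-! ### Generic algebra: `N`-th powers with equal residues; monomials in units -/

section Generic

variable {T : Type*} [CommRing T]

/-- In a commutative ring with a "residue" homomorphism to `ℝ` that detects units (every element of
nonzero residue is a unit), two `N`-th roots of the same element with the same nonzero residue are
equal: `α^N = β^N`, `res α = res β ≠ 0` `⇒ α = β` (`α^N − β^N = (α − β) · s` with `res s = N (res α)^{N−1}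
≠ 0`). [cite: BihanSottile2008, §2 (proof of Thm. 2.2)] -/
theorem eq_of_pow_eq_pow_of_residue (res : T →+* ℝ) (hres : ∀ t : T, res t ≠ 0 → IsUnit t)
    {α β : T} {N : ℕ} (hN : 0 < N) (hpow : α ^ N = β ^ N) (hαβ : res α = res β)
    (hα : res α ≠ 0) : α = β := by
  have hfac := geom_sum₂_mul α β N
  rw [hpow, sub_self] at hfac
  have hunit : IsUnit (∑ i ∈ range N, α ^ i * β ^ (N - 1 - i)) := by
    apply hres
    rw [map_sum]
    simp only [map_mul, map_pow, ← hαβ]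
    have : ∀ i ∈ range N, res α ^ i * res α ^ (N - 1 - i) = res α ^ (N - 1) := by
      intro i hi
      rw [← pow_add]
      congr 1
      have := mem_range.mp hi
      omega
    rw [sum_congr rfl this, sum_const, card_range, nsmul_eq_mul]
    exact mul_ne_zero (by exact_mod_cast hN.ne') (pow_ne_zero _ hα)
  exact sub_eq_zero.mp (hunit.mul_right_eq_zero.mp hfac)

/-- A ring homomorphism to `ℝ` on an integer power of a unit. [folklore] -/
private theorem ringHom_val_zpow (res : T →+* ℝ) (U : Tˣ) (z : ℤ) :
    res ↑(U ^ z) = (res ↑U) ^ z := by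
  have h : ((Units.map (res : T →* ℝ) (U ^ z) : ℝˣ) : ℝ) = ((Units.map (res : T →* ℝ) U : ℝˣ) : ℝ) ^ z := by
    rw [map_zpow, Units.val_zpow_eq_zpow_val]
  simpa only [Units.coe_map, MonoidHom.coe_coe] using h

variable {n : ℕ}

/-- `ξ^u = ∏_k ξ_k^{u_k}` for a family of units `ξ_k` and an integer exponent vector `u ∈ ℤ^n` (the
Laurent monomials of the torus, [BS08] §1). [cite: BihanSottile2008, §1] -/
def umon (ξ : Fin n → Tˣ) (u : Fin n → ℤ) : Tˣ := ∏ k, ξ k ^ u k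

/-- `ξ^{u+v} = ξ^u ξ^v`. [cite: BihanSottile2008, §1] -/
theorem umon_add (ξ : Fin n → Tˣ) (u v : Fin n → ℤ) : umon ξ (u + v) = umon ξ u * umon ξ v := by
  simp [umon, _root_.zpow_add, prod_mul_distrib]

/-- `ξ^0 = 1`. [cite: BihanSottile2008, §1] -/
theorem umon_zero (ξ : Fin n → Tˣ) : umon ξ 0 = 1 := by simp [umon]

/-- `ξ^{−u} = (ξ^u)⁻¹`. [cite: BihanSottile2008, §1] -/
theorem umon_neg (ξ : Fin n → Tˣ) (u : Fin n → ℤ) : umon ξ (-u) = (umon ξ u)⁻¹ := by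
  simp [umon, prod_inv_distrib]

/-- `ξ^{u−v} = ξ^u (ξ^v)⁻¹`. [cite: BihanSottile2008, §1] -/
theorem umon_sub (ξ : Fin n → Tˣ) (u v : Fin n → ℤ) : umon ξ (u - v) = umon ξ u * (umon ξ v)⁻¹ := by
  rw [sub_eq_add_neg, umon_add, umon_neg]

/-- `ξ^{c u} = (ξ^u)^c`. [cite: BihanSottile2008, §1] -/
theorem umon_zsmul (ξ : Fin n → Tˣ) (c : ℤ) (u : Fin n → ℤ) : umon ξ (c • u) = umon ξ u ^ c := by
  simp only [umon, Pi.smul_apply, smul_eq_mul]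
  rw [← prod_zpow]
  refine prod_congr rfl fun k _ => ?_
  rw [mul_comm, _root_.zpow_mul]

/-- `ξ^{∑ u_i} = ∏ ξ^{u_i}`. [cite: BihanSottile2008, §1] -/
theorem umon_sum (ξ : Fin n → Tˣ) {ι : Type*} (s : Finset ι) (u : ι → Fin n → ℤ) :
    umon ξ (∑ i ∈ s, u i) = ∏ i ∈ s, umon ξ (u i) := by
  classical
  induction s using Finset.induction_on with
  | empty => simp [umon_zero]
  | insert i s hi ih => rw [sum_insert hi, prod_insert hi, umon_add, ih]

/-- `ξ^{∑ c_i u_i} = ∏ (ξ^{u_i})^{c_i}`. [cite: BihanSottile2008, §1] -/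
theorem umon_sum_zsmul (ξ : Fin n → Tˣ) {ι : Type*} (s : Finset ι) (c : ι → ℤ)
    (u : ι → Fin n → ℤ) : umon ξ (∑ i ∈ s, c i • u i) = ∏ i ∈ s, umon ξ (u i) ^ c i := by
  rw [umon_sum]
  exact prod_congr rfl fun i _ => umon_zsmul ξ (c i) (u i)

/-- `ξ^{z e_{k₀}} = ξ_{k₀}^z`. [cite: BihanSottile2008, §1] -/
theorem umon_single (ξ : Fin n → Tˣ) (k₀ : Fin n) (z : ℤ) :
    umon ξ (fun k => if k = k₀ then z else 0) = ξ k₀ ^ z := by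
  unfold umon
  rw [Finset.prod_eq_single k₀]
  · simp
  · intro k _ hk
    simp [hk]
  · intro h
    exact absurd (mem_univ _) h

/-- Monomials are transported by monoid homomorphisms. [cite: BihanSottile2008, §1] -/
theorem map_umon {T' : Type*} [CommRing T'] (φ : T →* T') (ξ : Fin n → Tˣ) (u : Fin n → ℤ) :
    Units.map φ (umon ξ u) = umon (fun k => Units.map φ (ξ k)) u := by
  simp [umon, map_prod, map_zpow]

/-- Monomials are transported by ring homomorphisms (value level). [cite: BihanSottile2008, §1] -/
theorem map_val_umon {T' : Type*} [CommRing T'] (φ : T →+* T') (ξ : Fin n → Tˣ) (ξ' : Fin n → T'ˣ)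
    (hξ : ∀ k, (ξ' k : T') = φ (ξ k)) (u : Fin n → ℤ) : φ (umon ξ u) = (umon ξ' u : T') := by
  have : ξ' = fun k => Units.map (φ : T →* T') (ξ k) := funext fun k => Units.ext (hξ k)
  subst this
  rw [← map_umon]
  rfl

/-- The residue of a monomial is the monomial of the residues. [cite: BihanSottile2008, §1] -/
theorem residue_umon (res : T →+* ℝ) (ξ : Fin n → Tˣ) (u : Fin n → ℤ) :
    res ↑(umon ξ u) = ∏ k, (res ↑(ξ k)) ^ u k := by
  unfold umon
  rw [Units.coe_prod, map_prod]
  exact prod_congr rfl fun k _ => ringHom_val_zpow res (ξ k) (u k)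

/-- `residue_umon` for an `ℝ`-algebra homomorphism. [cite: BihanSottile2008, §1] -/
theorem residue_umon_alg [Algebra ℝ T] (res : T →ₐ[ℝ] ℝ) (ξ : Fin n → Tˣ) (u : Fin n → ℤ) :
    res ↑(umon ξ u) = ∏ k, (res ↑(ξ k)) ^ u k :=
  residue_umon res.toRingHom ξ u

/-- `ringHom_val_zpow` for an `ℝ`-algebra homomorphism. [folklore] -/
private theorem algHom_val_zpow [Algebra ℝ T] (res : T →ₐ[ℝ] ℝ) (U : Tˣ) (z : ℤ) :
    res ↑(U ^ z) = (res ↑U) ^ z :=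
  ringHom_val_zpow res.toRingHom U z

/-- A homomorphism to `ℝ` on the inverse of a unit. [folklore] -/
private theorem algHom_val_inv [Algebra ℝ T] (res : T →ₐ[ℝ] ℝ) (U : Tˣ) : res ↑U⁻¹ = (res ↑U)⁻¹ :=
  eq_inv_of_mul_eq_one_left (by rw [← map_mul, Units.inv_mul, map_one])

/-- `eq_of_pow_eq_pow_of_residue` for an `ℝ`-algebra homomorphism. [cite: BihanSottile2008, §2] -/
theorem eq_of_pow_eq_pow_of_residue_alg [Algebra ℝ T] (res : T →ₐ[ℝ] ℝ)
    (hres : ∀ t : T, res t ≠ 0 → IsUnit t) {α β : T} {N : ℕ} (hN : 0 < N) (hpow : α ^ N = β ^ N)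
    (hαβ : res α = res β) (hα : res α ≠ 0) : α = β :=
  eq_of_pow_eq_pow_of_residue res.toRingHom hres hN hpow hαβ hα

end Generic

/-! ### The truncated polynomial ring `ℝ[Y]/((Y − y₀)^m)`: residue, units, Hensel, dimension -/

section Trunc

variable (y₀ : ℝ) (m : ℕ)

/-- The residue map `ℝ[Y]/((Y − y₀)^m) → ℝ`, `Y ↦ y₀` (`m ≥ 1`). [cite: BihanSottile2008, §2] -/
def truncRes (hm : 0 < m) : AdjoinRoot ((X - C y₀) ^ m) →ₐ[ℝ] ℝ :=
  AdjoinRoot.liftAlgHom ((X - C y₀) ^ m) (Algebra.ofId ℝ ℝ) y₀ (by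
    have : (0 : ℝ) ^ m = 0 := zero_pow hm.ne'
    simpa [eval₂_pow, eval₂_sub] using this)

variable {y₀ m}

/-- The residue of the class of `q` is `q(y₀)`. [folklore] -/
private theorem truncRes_mk (hm : 0 < m) (q : ℝ[X]) :
    truncRes y₀ m hm (AdjoinRoot.mk _ q) = q.eval y₀ := by
  rw [truncRes, AdjoinRoot.liftAlgHom_mk]
  rw [eval₂_eq_eval_map]
  simp

/-- The residue of `Ȳ` is `y₀`. [folklore] -/
private theorem truncRes_root (hm : 0 < m) : truncRes y₀ m hm (AdjoinRoot.root _) = y₀ := by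
  rw [AdjoinRoot.root, truncRes_mk, eval_X]

/-- `Y − y₀` is nilpotent in `ℝ[Y]/((Y − y₀)^m)`. [folklore] -/
private theorem isNilpotent_root_sub : IsNilpotent (AdjoinRoot.mk ((X - C y₀) ^ m) (X - C y₀)) :=
  ⟨m, by rw [← map_pow, AdjoinRoot.mk_self]⟩

/-- An element of `ℝ[Y]/((Y − y₀)^m)` with nonzero residue is a unit (it is a nonzero constant plus a
nilpotent). [cite: BihanSottile2008, §2] -/
theorem isUnit_of_truncRes_ne_zero (hm : 0 < m) (d : AdjoinRoot ((X - C y₀) ^ m))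
    (hd : truncRes y₀ m hm d ≠ 0) : IsUnit d := by
  obtain ⟨q, rfl⟩ := AdjoinRoot.mk_surjective d
  rw [truncRes_mk] at hd
  have hq : q = C (q.eval y₀) + (X - C y₀) * (q /ₘ (X - C y₀)) := by
    have := modByMonic_add_div q (X - C y₀)
    rw [modByMonic_X_sub_C_eq_C_eval] at this
    exact this.symm
  rw [hq, map_add, map_mul, AdjoinRoot.mk_C]
  refine IsNilpotent.isUnit_add_left_of_commute ?_ ?_ (Commute.all _ _)
  · exact Commute.isNilpotent_mul_right (Commute.all _ _) isNilpotent_root_sub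
  · exact (Ne.isUnit hd).map (AdjoinRoot.of _)

/-- The ideal `(Y − y₀)` of `ℝ[Y]/((Y − y₀)^m)` is nilpotent, so the ring is `(Y − y₀)`-adically
complete (trivially) and hence Henselian. [folklore] -/
private theorem isAdicComplete_trunc :
    IsAdicComplete (Ideal.span {AdjoinRoot.mk ((X - C y₀) ^ m) (X - C y₀)})
      (AdjoinRoot ((X - C y₀) ^ m)) := by
  set I := Ideal.span {AdjoinRoot.mk ((X - C y₀) ^ m) (X - C y₀)} with hI
  have hIm : I ^ m = 0 := by
    rw [hI, Ideal.span_singleton_pow, ← map_pow, AdjoinRoot.mk_self, Ideal.zero_eq_bot,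
      Ideal.span_singleton_eq_bot]
  exact
    { haus' := fun x hx => by
        have h := hx m
        rw [hIm, zero_smul, Ideal.zero_eq_bot, SModEq.bot] at h
        exact h
      prec' := fun f hf => by
        refine ⟨f m, fun k => ?_⟩
        by_cases hk : k ≤ m
        · exact hf hk
        · have h := hf (le_of_not_ge hk)
          rw [hIm, zero_smul, Ideal.zero_eq_bot, SModEq.bot] at h
          rw [h] }

/-- The residue map kills the ideal `(Y − y₀)` … and conversely an element of residue `0` lies in
it. [folklore] -/
private theorem mem_span_root_sub_of_truncRes_eq_zero (hm : 0 < m) (d : AdjoinRoot ((X - C y₀) ^ m))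
    (hd : truncRes y₀ m hm d = 0) :
    d ∈ Ideal.span {AdjoinRoot.mk ((X - C y₀) ^ m) (X - C y₀)} := by
  obtain ⟨q, rfl⟩ := AdjoinRoot.mk_surjective d
  rw [truncRes_mk] at hd
  have hq : q = (X - C y₀) * (q /ₘ (X - C y₀)) := by
    have := modByMonic_add_div q (X - C y₀)
    rw [modByMonic_X_sub_C_eq_C_eval, hd, map_zero, zero_add] at this
    exact this.symm
  rw [hq, map_mul]
  exact Ideal.mul_mem_right _ _ (Ideal.subset_span rfl)

/-- The residue vanishes on the ideal `(Y − y₀)`. [folklore] -/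
private theorem truncRes_eq_zero_of_mem_span (hm : 0 < m) (d : AdjoinRoot ((X - C y₀) ^ m))
    (hd : d ∈ Ideal.span {AdjoinRoot.mk ((X - C y₀) ^ m) (X - C y₀)}) :
    truncRes y₀ m hm d = 0 := by
  obtain ⟨r, rfl⟩ := Ideal.mem_span_singleton'.mp hd
  rw [map_mul, truncRes_mk, eval_sub, eval_X, eval_C, sub_self, mul_zero]

/-- **Hensel in `ℝ[Y]/((Y − y₀)^m)`**: an element whose residue is `c^N` with `c ≠ 0` (`N ≥ 1`) has an
`N`-th root of residue `c`. [cite: BihanSottile2008, §2 (proof of Thm. 2.2)] -/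
theorem exists_pow_eq_of_truncRes (hm : 0 < m) {N : ℕ} (hN : 0 < N)
    (q : AdjoinRoot ((X - C y₀) ^ m)) (c : ℝ) (hc : c ≠ 0) (hq : truncRes y₀ m hm q = c ^ N) :
    ∃ ρ : AdjoinRoot ((X - C y₀) ^ m), ρ ^ N = q ∧ truncRes y₀ m hm ρ = c := by
  haveI := isAdicComplete_trunc (y₀ := y₀) (m := m)
  set I := Ideal.span {AdjoinRoot.mk ((X - C y₀) ^ m) (X - C y₀)} with hI
  set f : (AdjoinRoot ((X - C y₀) ^ m))[X] := X ^ N - C q with hf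
  have hmonic : f.Monic := monic_X_pow_sub_C q hN.ne'
  set a₀ : AdjoinRoot ((X - C y₀) ^ m) := algebraMap ℝ _ c with ha₀
  have hres_a₀ : truncRes y₀ m hm a₀ = c := by rw [ha₀, AlgHom.commutes]; rfl
  have h1 : f.eval a₀ ∈ I := by
    apply mem_span_root_sub_of_truncRes_eq_zero hm
    rw [hf, eval_sub, eval_pow, eval_X, eval_C, map_sub, map_pow, hres_a₀, hq, sub_self]
  have h2 : IsUnit (Ideal.Quotient.mk I (f.derivative.eval a₀)) := by
    refine IsUnit.map _ ?_
    have hder : f.derivative.eval a₀ = algebraMap ℝ _ ((N : ℝ) * c ^ (N - 1)) := by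
      rw [hf, derivative_sub, derivative_X_pow, derivative_C, sub_zero, eval_mul, eval_pow, eval_X,
        ha₀, map_mul, map_pow]
      simp
    rw [hder]
    exact (Ne.isUnit (mul_ne_zero (by exact_mod_cast hN.ne') (pow_ne_zero _ hc))).map _
  obtain ⟨ρ, hroot, hρ⟩ := HenselianRing.is_henselian (R := AdjoinRoot ((X - C y₀) ^ m)) (I := I)
    f hmonic a₀ h1 h2
  refine ⟨ρ, ?_, ?_⟩
  · have := hroot
    rw [IsRoot.def, hf, eval_sub, eval_pow, eval_X, eval_C, sub_eq_zero] at this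
    exact this
  · have h0 := truncRes_eq_zero_of_mem_span hm _ hρ
    rw [map_sub, hres_a₀, sub_eq_zero] at h0
    exact h0

/-- `dim_ℝ ℝ[Y]/((Y − y₀)^m) = m`. [folklore] -/
private theorem finrank_trunc : Module.finrank ℝ (AdjoinRoot ((X - C y₀) ^ m)) = m := by
  have hne : (X - C y₀) ^ m ≠ 0 := pow_ne_zero _ (X_sub_C_ne_zero y₀)
  rw [(AdjoinRoot.powerBasis hne).finrank, AdjoinRoot.powerBasis_dim, natDegree_pow,
    natDegree_X_sub_C, mul_one]

end Trunc

/-! ### Index bookkeeping: `[n+2] = {a, b} ⊔ S`, `S` enumerated increasingly -/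

section Index

variable {n : ℕ}

/-- `|[n+2] ∖ {a, b}| = n` for `a ≠ b` (the column count of the minor `C(a,b)`). [cite: BihanDickenstein2017, §2.2] -/
theorem card_univ_sdiff_pair {a b : Fin (n + 2)} (hab : a ≠ b) :
    ((Finset.univ : Finset (Fin (n + 2))) \ {a, b}).card = n := by
  rw [Finset.card_sdiff_of_subset (Finset.subset_univ _), Finset.card_univ, Fintype.card_fin,
    Finset.card_pair hab, Nat.add_sub_cancel]

/-- The increasing enumeration `S = {e_0 < ⋯ < e_{n−1}}` of `[n+2] ∖ {a, b}` (the column set of the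
minor `C(a,b)`, "in the same order", p0006:L6). [cite: BihanDickenstein2017, §2.2] -/
def pairCompl {a b : Fin (n + 2)} (hab : a ≠ b) : Fin n ↪o Fin (n + 2) :=
  ((Finset.univ : Finset (Fin (n + 2))) \ {a, b}).orderEmbOfFin (card_univ_sdiff_pair hab)

/-- `e_t ∈ [n+2] ∖ {a, b}`. [cite: BihanDickenstein2017, §2.2] -/
theorem pairCompl_mem {a b : Fin (n + 2)} (hab : a ≠ b) (t : Fin n) :
    pairCompl hab t ∈ (Finset.univ : Finset (Fin (n + 2))) \ {a, b} :=
  Finset.orderEmbOfFin_mem _ _ t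

/-- `e_t ≠ a`. [cite: BihanDickenstein2017, §2.2] -/
theorem pairCompl_ne_left {a b : Fin (n + 2)} (hab : a ≠ b) (t : Fin n) : pairCompl hab t ≠ a := by
  have h := pairCompl_mem hab t
  simp only [Finset.mem_sdiff, Finset.mem_univ, Finset.mem_insert, Finset.mem_singleton,
    true_and, not_or] at h
  exact h.1

/-- `e_t ≠ b`. [cite: BihanDickenstein2017, §2.2] -/
theorem pairCompl_ne_right {a b : Fin (n + 2)} (hab : a ≠ b) (t : Fin n) : pairCompl hab t ≠ b := by
  have h := pairCompl_mem hab t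
  simp only [Finset.mem_sdiff, Finset.mem_univ, Finset.mem_insert, Finset.mem_singleton,
    true_and, not_or] at h
  exact h.2

/-- Every index is `a`, `b` or some `e_t`. [cite: BihanDickenstein2017, §2.2] -/
theorem eq_or_eq_or_exists_pairCompl {a b : Fin (n + 2)} (hab : a ≠ b) (ℓ : Fin (n + 2)) :
    ℓ = a ∨ ℓ = b ∨ ∃ t, pairCompl hab t = ℓ := by
  by_cases ha : ℓ = a
  · exact Or.inl ha
  by_cases hb : ℓ = b
  · exact Or.inr (Or.inl hb)
  refine Or.inr (Or.inr ?_)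
  have hmem : ℓ ∈ (Finset.univ : Finset (Fin (n + 2))) \ {a, b} := by simp [ha, hb]
  have hr := Finset.range_orderEmbOfFin ((Finset.univ : Finset (Fin (n + 2))) \ {a, b})
    (card_univ_sdiff_pair hab)
  have : ℓ ∈ Set.range (pairCompl hab) := by
    rw [pairCompl, hr]
    exact hmem
  exact this

/-- `∑_{ℓ ∈ [n+2]} f(ℓ) = f(a) + f(b) + ∑_t f(e_t)`. [cite: BihanDickenstein2017, §2.2] -/
theorem sum_eq_pair_add_sum_pairCompl {M : Type*} [AddCommMonoid M] {a b : Fin (n + 2)}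
    (hab : a ≠ b) (f : Fin (n + 2) → M) :
    ∑ ℓ, f ℓ = f a + f b + ∑ t, f (pairCompl hab t) := by
  rw [← Finset.sum_sdiff (Finset.subset_univ ({a, b} : Finset (Fin (n + 2)))),
    Finset.sum_pair hab, add_comm]
  congr 1
  rw [← Finset.map_orderEmbOfFin_univ _ (card_univ_sdiff_pair hab), Finset.sum_map]
  rfl

end Index

/-! ### The local ring `ℝ[X]_{𝔪_x}` at a positive point: evaluation, units, monomials -/

section LocalAlgebra

variable {n : ℕ}

/-- `𝔪_x` is a maximal ideal (evaluation at `x` is onto `ℝ`). [folklore] -/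
instance isMaximal_pointIdeal (x : Fin n → ℝ) : (pointIdeal x).IsMaximal :=
  RingHom.ker_isMaximal_of_surjective (MvPolynomial.eval x) fun a =>
    ⟨MvPolynomial.C a, MvPolynomial.eval_C a⟩

/-- `F ∈ 𝔪_x ⟺ F(x) = 0`. [cite: BihanDickenstein2017, §1 eq. (1.1)] -/
theorem mem_pointIdeal_iff (x : Fin n → ℝ) (p : MvPolynomial (Fin n) ℝ) :
    p ∈ pointIdeal x ↔ MvPolynomial.eval x p = 0 := RingHom.mem_ker

/-- Evaluation at `x` extends to the local ring `ℝ[X]_{𝔪_x}` (denominators do not vanish at `x`).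
[cite: BihanSottile2008, §2] -/
def locEval (x : Fin n → ℝ) : Localization.AtPrime (pointIdeal x) →ₐ[ℝ] ℝ :=
  IsLocalization.liftAlgHom (M := (pointIdeal x).primeCompl) (f := MvPolynomial.aeval x)
    (fun s => by
      have hs : MvPolynomial.eval x s.1 ≠ 0 := fun h => s.2 ((mem_pointIdeal_iff x _).mpr h)
      exact Ne.isUnit hs)

/-- Evaluation at `x` on polynomials is evaluation. [cite: BihanSottile2008, §3] -/
theorem locEval_algebraMap (x : Fin n → ℝ) (p : MvPolynomial (Fin n) ℝ) :
    locEval x (algebraMap _ (Localization.AtPrime (pointIdeal x)) p) = MvPolynomial.eval x p := by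
  rw [locEval, IsLocalization.liftAlgHom_apply, IsLocalization.lift_eq]
  rfl

/-- In the local ring, an element is a unit iff its value at `x` is nonzero.
[cite: BihanSottile2008, §2] -/
theorem isUnit_iff_locEval_ne_zero (x : Fin n → ℝ) (o : Localization.AtPrime (pointIdeal x)) :
    IsUnit o ↔ locEval x o ≠ 0 := by
  constructor
  · intro h
    exact (h.map _).ne_zero
  · intro h
    obtain ⟨⟨r, s⟩, rfl⟩ := IsLocalization.mk'_surjective (pointIdeal x).primeCompl o
    apply (IsLocalization.AtPrime.isUnit_mk'_iff (Localization.AtPrime (pointIdeal x))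
      (pointIdeal x) r s).mpr
    intro hr
    apply h
    have hspec := IsLocalization.mk'_spec (Localization.AtPrime (pointIdeal x)) r s
    have h2 := congrArg (locEval x) hspec
    rw [map_mul, locEval_algebraMap, locEval_algebraMap, (mem_pointIdeal_iff x r).mp hr] at h2
    have hs : MvPolynomial.eval x s.1 ≠ 0 := fun h' => s.2 ((mem_pointIdeal_iff x _).mpr h')
    exact (mul_eq_zero.mp h2).resolve_right hs

/-- `X_k ∉ 𝔪_x` when `x_k ≠ 0` (torus coordinates). [cite: BihanSottile2008, §1] -/
theorem X_mem_primeCompl (x : Fin n → ℝ) (hx : ∀ k, x k ≠ 0) (k : Fin n) :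
    (MvPolynomial.X k : MvPolynomial (Fin n) ℝ) ∈ (pointIdeal x).primeCompl := by
  intro h
  rw [SetLike.mem_coe, mem_pointIdeal_iff, MvPolynomial.eval_X] at h
  exact hx k h

/-- The variables `X_k` as units of the local ring at a point with nonzero coordinates.
[cite: BihanSottile2008, §1] -/
def locXUnit (x : Fin n → ℝ) (hx : ∀ k, x k ≠ 0) (k : Fin n) :
    (Localization.AtPrime (pointIdeal x))ˣ :=
  (IsLocalization.map_units (Localization.AtPrime (pointIdeal x))
    ⟨MvPolynomial.X k, X_mem_primeCompl x hx k⟩).unit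

/-- The unit `X_k` is the variable `X_k`. [cite: BihanSottile2008, §1] -/
theorem val_locXUnit (x : Fin n → ℝ) (hx : ∀ k, x k ≠ 0) (k : Fin n) :
    (locXUnit x hx k : Localization.AtPrime (pointIdeal x)) =
      algebraMap (MvPolynomial (Fin n) ℝ) (Localization.AtPrime (pointIdeal x))
        (MvPolynomial.X k) :=
  IsUnit.unit_spec _

/-- `X_k(x) = x_k`. [cite: BihanSottile2008, §1] -/
theorem locEval_locXUnit (x : Fin n → ℝ) (hx : ∀ k, x k ≠ 0) (k : Fin n) :
    locEval x (locXUnit x hx k : Localization.AtPrime (pointIdeal x)) = x k := by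
  rw [val_locXUnit, locEval_algebraMap, MvPolynomial.eval_X]

/-- The Laurent monomial `X^u`, `u ∈ ℤ^n`, as a unit of the local ring. [cite: BihanSottile2008, §1] -/
def locMon (x : Fin n → ℝ) (hx : ∀ k, x k ≠ 0) (u : Fin n → ℤ) :
    (Localization.AtPrime (pointIdeal x))ˣ :=
  umon (locXUnit x hx) u

/-- `X^u(x) = x^u`. [cite: BihanSottile2008, §1] -/
theorem locEval_locMon (x : Fin n → ℝ) (hx : ∀ k, x k ≠ 0) (u : Fin n → ℤ) :
    locEval x (locMon x hx u : Localization.AtPrime (pointIdeal x)) = monomial u x := by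
  rw [locMon, residue_umon_alg]
  simp only [monomial, locEval_locXUnit]

/-- For a nonnegative exponent vector the Laurent monomial is the honest monomial.
[cite: BihanSottile2008, §1] -/
theorem val_locMon_of_nonneg (x : Fin n → ℝ) (hx : ∀ k, x k ≠ 0) (u : Fin n → ℤ)
    (hu : ∀ k, 0 ≤ u k) :
    (locMon x hx u : Localization.AtPrime (pointIdeal x)) =
      algebraMap (MvPolynomial (Fin n) ℝ) (Localization.AtPrime (pointIdeal x))
        (∏ k, MvPolynomial.X k ^ (u k).toNat) := by
  rw [locMon, umon, Units.coe_prod, map_prod]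
  refine Finset.prod_congr rfl fun k _ => ?_
  rw [map_pow, ← val_locXUnit x hx k, ← Units.val_pow_eq_pow_val]
  congr 1
  conv_lhs => rw [← Int.toNat_of_nonneg (hu k)]
  exact zpow_natCast _ _

end LocalAlgebra

/-! ### §4.2: the normalized Gale basis `P^j, P^i` and the polynomial `∏ p_ℓ^{μ_ℓ⁺} − ∏ p_ℓ^{μ_ℓ⁻}` -/

section GaleLocal

variable {n : ℕ}

/-- `p_ℓ(Y) = P_{ℓ,1} + P_{ℓ,2} Y` (4.1) as a polynomial (its evaluation is `BD17.galeLin`).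
[cite: BihanDickenstein2017, §4.1 eq. (4.1)] -/
def linPoly (B : Matrix (Fin (n + 2)) (Fin 2) ℝ) (ℓ : Fin (n + 2)) : ℝ[X] :=
  C (B ℓ 0) + C (B ℓ 1) * X

/-- `p_ℓ(y) = ⟨P_ℓ, (1, y)⟩` (4.1): the polynomial evaluates to `BD17.galeLin`. [cite: BihanDickenstein2017, §4.1 eq. (4.1)] -/
theorem eval_linPoly (B : Matrix (Fin (n + 2)) (Fin 2) ℝ) (ℓ : Fin (n + 2)) (y : ℝ) :
    (linPoly B ℓ).eval y = galeLin B ℓ y := by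
  simp [linPoly, galeLin]

/-- "`g(y) = 1` if and only if `y` is a root of the polynomial `∏_{μ_ℓ>0} p_ℓ(y)^{μ_ℓ} −
∏_{μ_ℓ<0} p_ℓ(y)^{−μ_ℓ}`" (p0011:L62–63), for an integer affine relation `μ` of `𝒜` (the print
takes `μ = λ̃`; the multiplicity statement below holds for every integer relation `μ ∈ ker A` with
`μ_b ≠ 0`, in particular for `λ` and `λ̃`). [cite: BihanDickenstein2017, §4.2 (proof of Thm. 2.9)] -/
def galePoly (B : Matrix (Fin (n + 2)) (Fin 2) ℝ) (μ : Fin (n + 2) → ℤ) : ℝ[X] :=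
  ∏ ℓ ∈ Finset.univ.filter (fun ℓ => 0 < μ ℓ), linPoly B ℓ ^ (μ ℓ).toNat -
    ∏ ℓ ∈ Finset.univ.filter (fun ℓ => μ ℓ < 0), linPoly B ℓ ^ (-μ ℓ).toNat

/-- The NORMALIZED Gale dual basis of the proof of Thm. 2.9 (p0011:L22–33): the columns of `B` are
kernel vectors `P^j, P^i` of `C` with `P_a = (1, 0)` and `P_b = (0, 1)` read in the rows `a = ᾱ_i`,
`b = ᾱ_j` ("`P^i_{ᾱ_i} = P^j_{ᾱ_j} = 0`, and `P^i_{ᾱ_j} = P^j_{ᾱ_i} = 1`").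
[cite: BihanDickenstein2017, §4.2 (before the proof of Thm. 2.9)] -/
structure IsNormalizedGaleBasis (C : Matrix (Fin n) (Fin (n + 2)) ℝ) (a b : Fin (n + 2))
    (B : Matrix (Fin (n + 2)) (Fin 2) ℝ) : Prop where
  mulVec_col : ∀ t : Fin 2, C.mulVec (fun ℓ => B ℓ t) = 0
  left_fst : B a 0 = 1
  left_snd : B a 1 = 0
  right_fst : B b 0 = 0
  right_snd : B b 1 = 1

/-- The data of §4.2 at ONE positive solution `x`: `A`, `C` of ranks `n + 1`, `n` (1.3), `𝒜` a
circuit, two indices `a ≠ b` with `det C(a, b) ≠ 0` (any two distinct elements of `K`), the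
normalized Gale basis at `(a, b)`, and `x ∈ ℝ^n_{>0}` a solution of (1.1).
[cite: BihanDickenstein2017, §4.2 (proof of Thm. 2.9)] -/
structure GaleLocalData (w : Fin (n + 2) → Fin n → ℤ) (C : Matrix (Fin n) (Fin (n + 2)) ℝ)
    (a b : Fin (n + 2)) (B : Matrix (Fin (n + 2)) (Fin 2) ℝ) (x : Fin n → ℝ) : Prop where
  rank : RankCond w C
  circuit : IsCircuit w
  ne : a ≠ b
  minor : coeffMinor C a b ≠ 0
  basis : IsNormalizedGaleBasis C a b B
  mem : x ∈ posSolutions w C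

namespace GaleLocalData

variable {w : Fin (n + 2) → Fin n → ℤ} {C : Matrix (Fin n) (Fin (n + 2)) ℝ} {a b : Fin (n + 2)}
  {B : Matrix (Fin (n + 2)) (Fin 2) ℝ} {x : Fin n → ℝ}

/-- A positive solution has positive coordinates. [cite: BihanDickenstein2017, §1 eq. (1.1)] -/
theorem pos (h : GaleLocalData w C a b B x) (k : Fin n) : 0 < x k := h.mem.1 k

/-- A positive solution has nonzero coordinates. [cite: BihanDickenstein2017, §1 eq. (1.1)] -/
theorem ne_zero (h : GaleLocalData w C a b B x) : ∀ k, x k ≠ 0 := fun k => (h.pos k).ne'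

/-- A positive solution solves (1.1). [cite: BihanDickenstein2017, §1 eq. (1.1)] -/
theorem sol (h : GaleLocalData w C a b B x) (i : Fin n) : systemEval w C x i = 0 := h.mem.2 i

/-- The normalized basis is a Gale dual of `C`. [cite: BihanDickenstein2017, §4.2] -/
theorem isGaleDual (h : GaleLocalData w C a b B x) : IsGaleDual C B := by
  have hu : C.mulVec (fun ℓ => B ℓ 0) = 0 := h.basis.mulVec_col 0
  have he : C.mulVec (fun ℓ => B ℓ 1) = 0 := h.basis.mulVec_col 1
  have hu0 : (fun ℓ => B ℓ 0) ≠ 0 := by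
    intro h0
    have := congr_fun h0 a
    rw [h.basis.left_fst] at this
    exact one_ne_zero this
  have hespan : (fun ℓ => B ℓ 1) ∉ Submodule.span ℝ {fun ℓ => B ℓ 0} := by
    intro hmem
    rw [Submodule.mem_span_singleton] at hmem
    obtain ⟨c, hc⟩ := hmem
    have hca := congr_fun hc a
    have hcb := congr_fun hc b
    simp only [Pi.smul_apply, smul_eq_mul, h.basis.left_fst, h.basis.left_snd, h.basis.right_fst,
      h.basis.right_snd, mul_one, mul_zero] at hca hcb
    exact zero_ne_one hcb
  have hG := isGaleDual_pair C h.rank.2 hu hu0 he hespan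
  have hBeq : (Matrix.of fun j t => (![fun ℓ => B ℓ 0, fun ℓ => B ℓ 1] : Fin 2 → Fin (n + 2) → ℝ) t j)
      = B := by
    ext j t
    fin_cases t <;> simp
  rw [hBeq] at hG
  exact hG

/-- `x^{w_ℓ} = P_{ℓ,1} x^{w_a} + P_{ℓ,2} x^{w_b}` (4.3). [cite: BihanDickenstein2017, §4.2 eq. (4.3)] -/
theorem monomial_eq (h : GaleLocalData w C a b B x) (ℓ : Fin (n + 2)) :
    monomial (w ℓ) x = monomial (w a) x * B ℓ 0 + monomial (w b) x * B ℓ 1 := by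
  have hker : C.mulVec (fun j => monomial (w j) x) = 0 := ((mem_posSolutions_iff w C x).mp h.mem).2
  obtain ⟨α, β, hαβ⟩ := exists_coeffs_of_isGaleDual h.isGaleDual hker
  have ha := hαβ a
  have hb := hαβ b
  rw [h.basis.left_fst, h.basis.left_snd] at ha
  rw [h.basis.right_fst, h.basis.right_snd] at hb
  simp only [mul_one, mul_zero, add_zero, zero_add] at ha hb
  rw [hαβ ℓ, ← ha, ← hb]

/-- `x^{w_ℓ − w_a} = p_ℓ(y₀)`, `y₀ = x^{w_b − w_a}`: the point of the Gale interval corresponding to the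
solution `x`. [cite: BihanDickenstein2017, §4.2 (proof of Thm. 2.9)] -/
theorem monomial_sub_eq_galeLin (h : GaleLocalData w C a b B x) (ℓ : Fin (n + 2)) :
    monomial (w ℓ - w a) x = galeLin B ℓ (monomial (w b - w a) x) := by
  have hpos := monomial_pos (w a) h.pos
  have e1 : monomial (w ℓ - w a) x = monomial (w ℓ) x / monomial (w a) x := by
    rw [eq_div_iff hpos.ne', monomial, monomial, monomial, ← Finset.prod_mul_distrib]
    exact Finset.prod_congr rfl fun k _ => by
      rw [← zpow_add₀ (h.ne_zero k), Pi.sub_apply, sub_add_cancel]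
  have e2 : monomial (w b - w a) x = monomial (w b) x / monomial (w a) x := by
    rw [eq_div_iff hpos.ne', monomial, monomial, monomial, ← Finset.prod_mul_distrib]
    exact Finset.prod_congr rfl fun k _ => by
      rw [← zpow_add₀ (h.ne_zero k), Pi.sub_apply, sub_add_cancel]
  rw [e1, e2, galeLin, h.monomial_eq ℓ]
  field_simp

/-- `y₀ = x^{w_b − w_a}` lies in the Gale interval `Δ_P`. [cite: BihanDickenstein2017, §4.2] -/
theorem mem_galeInterval (h : GaleLocalData w C a b B x) :
    monomial (w b - w a) x ∈ galeInterval B := fun ℓ => by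
  rw [← h.monomial_sub_eq_galeLin ℓ]
  exact monomial_pos _ h.pos

end GaleLocalData

/-! ### The generators `h_ℓ = X^{w_ℓ} − P_{ℓ,1} X^{w_a} − P_{ℓ,2} X^{w_b}` of the local ideal -/

/-- `h_ℓ = X^{w_ℓ} − P_{ℓ,1} X^{w_a} − P_{ℓ,2} X^{w_b}` in the local ring: the linear forms
"`Λ_i(z) = z_i − p_i(z)`" of [BS08] pulled back along the monomial map (the equations (4.3)).
[cite: BihanSottile2008, Thm. 2.2 (proof)] -/
def hgen (w : Fin (n + 2) → Fin n → ℤ) (B : Matrix (Fin (n + 2)) (Fin 2) ℝ) (a b : Fin (n + 2))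
    (x : Fin n → ℝ) (hx : ∀ k, x k ≠ 0) (ℓ : Fin (n + 2)) : Localization.AtPrime (pointIdeal x) :=
  (locMon x hx (w ℓ) : Localization.AtPrime (pointIdeal x)) -
    B ℓ 0 • (locMon x hx (w a) : Localization.AtPrime (pointIdeal x)) -
    B ℓ 1 • (locMon x hx (w b) : Localization.AtPrime (pointIdeal x))

/-- `min_j w_{j,k} ≤ w_{j,k}`. [cite: BihanDickenstein2017, §1 (after eq. (1.1))] -/
theorem expShift_le (w : Fin (n + 2) → Fin n → ℤ) (j : Fin (n + 2)) (k : Fin n) :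
    expShift w k ≤ w j k :=
  Finset.inf'_le _ (Finset.mem_univ j)

/-- The cleared equation in the local ring: `x^{−min} f_i = X^{−min} · ∑_j c_{ij} X^{w_j}`.
[cite: BihanDickenstein2017, §1 (after eq. (1.1))] -/
theorem algebraMap_shiftedPoly (w : Fin (n + 2) → Fin n → ℤ) (C : Matrix (Fin n) (Fin (n + 2)) ℝ)
    (x : Fin n → ℝ) (hx : ∀ k, x k ≠ 0) (i : Fin n) :
    algebraMap (MvPolynomial (Fin n) ℝ) (Localization.AtPrime (pointIdeal x)) (shiftedPoly w C i) =
      (↑(locMon x hx (expShift w))⁻¹ : Localization.AtPrime (pointIdeal x)) *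
        ∑ j, C i j • (locMon x hx (w j) : Localization.AtPrime (pointIdeal x)) := by
  rw [shiftedPoly, map_sum, Finset.mul_sum]
  refine Finset.sum_congr rfl fun j _ => ?_
  have hmon : algebraMap (MvPolynomial (Fin n) ℝ) (Localization.AtPrime (pointIdeal x))
      (∏ k, MvPolynomial.X k ^ (w j k - expShift w k).toNat) =
        (locMon x hx (w j - expShift w) : Localization.AtPrime (pointIdeal x)) := by
    rw [val_locMon_of_nonneg x hx (w j - expShift w) (fun k => sub_nonneg.mpr (expShift_le w j k))]
    rfl
  have hc : algebraMap (MvPolynomial (Fin n) ℝ) (Localization.AtPrime (pointIdeal x))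
      (MvPolynomial.C (C i j)) = algebraMap ℝ (Localization.AtPrime (pointIdeal x)) (C i j) := by
    rw [IsScalarTower.algebraMap_apply ℝ (MvPolynomial (Fin n) ℝ)
      (Localization.AtPrime (pointIdeal x)), MvPolynomial.algebraMap_eq]
  rw [map_mul, hmon, locMon, umon_sub, ← locMon, ← locMon, Units.val_mul, hc, Algebra.smul_def]
  ring

/-- `∑_j c_{ij} h_j = ∑_j c_{ij} X^{w_j}` (the correction terms vanish as `C P^j = C P^i = 0`).
[cite: BihanDickenstein2017, §4.2 (proof of Thm. 2.9)] -/
theorem sum_smul_hgen {w : Fin (n + 2) → Fin n → ℤ} {C : Matrix (Fin n) (Fin (n + 2)) ℝ}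
    {a b : Fin (n + 2)} {B : Matrix (Fin (n + 2)) (Fin 2) ℝ} (hB : IsNormalizedGaleBasis C a b B)
    (x : Fin n → ℝ) (hx : ∀ k, x k ≠ 0) (i : Fin n) :
    ∑ j, C i j • hgen w B a b x hx j =
      ∑ j, C i j • (locMon x hx (w j) : Localization.AtPrime (pointIdeal x)) := by
  have h0 : ∑ j, C i j * B j 0 = 0 := by
    have := congr_fun (hB.mulVec_col 0) i
    simpa [Matrix.mulVec, dotProduct] using this
  have h1 : ∑ j, C i j * B j 1 = 0 := by
    have := congr_fun (hB.mulVec_col 1) i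
    simpa [Matrix.mulVec, dotProduct] using this
  simp only [hgen, smul_sub, Finset.sum_sub_distrib, smul_smul, ← Finset.sum_smul, h0, h1,
    zero_smul, sub_zero]

/-- The generators `h_ℓ` generate: any homomorphism killing all `h_ℓ` kills the local ideal
`(f_1, …, f_n) ℝ[X]_{𝔪_x}`. [cite: BihanSottile2008, Thm. 2.2 (proof)] -/
theorem map_systemIdeal_le_ker {w : Fin (n + 2) → Fin n → ℤ} {C : Matrix (Fin n) (Fin (n + 2)) ℝ}
    {a b : Fin (n + 2)} {B : Matrix (Fin (n + 2)) (Fin 2) ℝ} (hB : IsNormalizedGaleBasis C a b B)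
    (x : Fin n → ℝ) (hx : ∀ k, x k ≠ 0) {T' : Type*} [CommRing T'] [Algebra ℝ T']
    (ψ : Localization.AtPrime (pointIdeal x) →ₐ[ℝ] T') (hψ : ∀ ℓ, ψ (hgen w B a b x hx ℓ) = 0) :
    (systemIdeal w C).map (algebraMap (MvPolynomial (Fin n) ℝ)
      (Localization.AtPrime (pointIdeal x))) ≤ RingHom.ker ψ := by
  rw [Ideal.map_le_iff_le_comap, systemIdeal, Ideal.span_le]
  rintro _ ⟨i, rfl⟩
  rw [SetLike.mem_coe, Ideal.mem_comap, RingHom.mem_ker,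
    algebraMap_shiftedPoly w C x hx i, map_mul, ← sum_smul_hgen hB x hx i, map_sum]
  simp [hψ]

/-- `h_a = 0`. [cite: BihanDickenstein2017, §4.2] -/
theorem hgen_left {w : Fin (n + 2) → Fin n → ℤ} {C : Matrix (Fin n) (Fin (n + 2)) ℝ}
    {a b : Fin (n + 2)} {B : Matrix (Fin (n + 2)) (Fin 2) ℝ} (hB : IsNormalizedGaleBasis C a b B)
    (x : Fin n → ℝ) (hx : ∀ k, x k ≠ 0) : hgen w B a b x hx a = 0 := by
  simp [hgen, hB.left_fst, hB.left_snd]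

/-- `h_b = 0`. [cite: BihanDickenstein2017, §4.2] -/
theorem hgen_right {w : Fin (n + 2) → Fin n → ℤ} {C : Matrix (Fin n) (Fin (n + 2)) ℝ}
    {a b : Fin (n + 2)} {B : Matrix (Fin (n + 2)) (Fin 2) ℝ} (hB : IsNormalizedGaleBasis C a b B)
    (x : Fin n → ℝ) (hx : ∀ k, x k ≠ 0) : hgen w B a b x hx b = 0 := by
  simp [hgen, hB.right_fst, hB.right_snd]

/-- The `h_ℓ` lie in the local ideal `(f_1, …, f_n) ℝ[X]_{𝔪_x}`: `f = C_S h` with `C_S` the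
invertible `n × n` submatrix of `C` on the columns `S = [n+2] ∖ {a, b}` (`det C(a,b) ≠ 0`).
[cite: BihanSottile2008, Thm. 2.2 (proof)] -/
theorem hgen_mem_map_systemIdeal {w : Fin (n + 2) → Fin n → ℤ} {C : Matrix (Fin n) (Fin (n + 2)) ℝ}
    {a b : Fin (n + 2)} {B : Matrix (Fin (n + 2)) (Fin 2) ℝ} {x : Fin n → ℝ}
    (h : GaleLocalData w C a b B x) (ℓ : Fin (n + 2)) :
    hgen w B a b x h.ne_zero ℓ ∈ (systemIdeal w C).map (algebraMap (MvPolynomial (Fin n) ℝ)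
      (Localization.AtPrime (pointIdeal x))) := by
  set J := (systemIdeal w C).map (algebraMap (MvPolynomial (Fin n) ℝ)
      (Localization.AtPrime (pointIdeal x))) with hJ
  rcases eq_or_eq_or_exists_pairCompl h.ne ℓ with rfl | rfl | ⟨t₀, rfl⟩
  · rw [hgen_left h.basis]; exact J.zero_mem
  · rw [hgen_right h.basis]; exact J.zero_mem
  · set e := pairCompl h.ne with he
    set CS : Matrix (Fin n) (Fin n) ℝ := C.submatrix id e with hCS
    have hdet : CS.det ≠ 0 := by
      have := h.minor
      rw [coeffMinor, dif_neg h.ne] at this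
      exact this
    set D := CS⁻¹ with hD
    have hDC : D * CS = 1 := Matrix.nonsing_inv_mul CS (Ne.isUnit hdet)
    -- the row identity `h_{e t₀} = ∑_i D_{t₀ i} (∑_j c_{ij} h_j)`
    have hsum : ∀ i, ∑ j, C i j • hgen w B a b x h.ne_zero j ∈ J := by
      intro i
      rw [sum_smul_hgen h.basis x h.ne_zero i]
      have hf : algebraMap (MvPolynomial (Fin n) ℝ) (Localization.AtPrime (pointIdeal x))
          (shiftedPoly w C i) ∈ J := Ideal.mem_map_of_mem _ (Ideal.subset_span ⟨i, rfl⟩)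
      have := J.mul_mem_left (locMon x h.ne_zero (expShift w) : Localization.AtPrime (pointIdeal x)) hf
      rwa [algebraMap_shiftedPoly w C x h.ne_zero i, ← mul_assoc, Units.mul_inv, one_mul] at this
    have hid : hgen w B a b x h.ne_zero (e t₀) =
        ∑ i, D t₀ i • ∑ j, C i j • hgen w B a b x h.ne_zero j := by
      have step1 : ∑ i, D t₀ i • ∑ j, C i j • hgen w B a b x h.ne_zero j =
          ∑ j, (D * C) t₀ j • hgen w B a b x h.ne_zero j := by
        simp only [Finset.smul_sum, smul_smul]
        rw [Finset.sum_comm]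
        refine Finset.sum_congr rfl fun j _ => ?_
        rw [← Finset.sum_smul, Matrix.mul_apply]
      rw [step1, sum_eq_pair_add_sum_pairCompl h.ne, hgen_left h.basis, hgen_right h.basis,
        smul_zero, smul_zero, zero_add, zero_add]
      have step2 : ∀ t, (D * C) t₀ (pairCompl h.ne t) = (D * CS) t₀ t := by
        intro t
        simp only [Matrix.mul_apply, hCS, Matrix.submatrix_apply, id]
        rfl
      simp only [step2, hDC, Matrix.one_apply, ite_smul, one_smul, zero_smul,
        Finset.sum_ite_eq, Finset.mem_univ, if_true]
      rfl
    rw [hid]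
    refine J.sum_mem fun i _ => ?_
    rw [Algebra.smul_def]
    exact J.mul_mem_left _ (hsum i)

end GaleLocal

/-! ### The exponent lattice `u_t = w_{e_t} − w_a`: a nonsingular integer matrix, adjugate identities -/

section Lattice

variable {n : ℕ}

/-- `U = (u_{e_t})_t`, `u_ℓ = w_ℓ − w_a`: the exponent vectors of the translated configuration ("up to a
translation of `𝒜` we can assume `w_{ᾱ_i} = 0`", p0011:L35) on the columns of `C(a,b)`.
[cite: BihanDickenstein2017, §4.2 (proof of Thm. 2.9)] -/
def expDiff (w : Fin (n + 2) → Fin n → ℤ) {a b : Fin (n + 2)} (hab : a ≠ b) :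
    Matrix (Fin n) (Fin n) ℤ :=
  Matrix.of fun k t => w (pairCompl hab t) k - w a k

/-- The `t`-th column of `U` is `u_t = w_{e_t} − w_a`. [cite: BihanDickenstein2017, §4.2 (proof of Thm. 2.9)] -/
theorem expDiff_col (w : Fin (n + 2) → Fin n → ℤ) {a b : Fin (n + 2)} (hab : a ≠ b) (t : Fin n) :
    (fun k => expDiff w hab k t) = w (pairCompl hab t) - w a := by
  funext k
  simp [expDiff]

/-- Row `0` of `A μ`: `∑_ℓ μ_ℓ`; row `k + 1`: `∑_ℓ μ_ℓ w_{ℓ,k}`. [cite: BihanDickenstein2017, §1 eq. (1.2)] -/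
theorem expMatrix_mulVec_zero (w : Fin (n + 2) → Fin n → ℤ) (μ : Fin (n + 2) → ℤ) :
    (expMatrix w).mulVec μ 0 = ∑ ℓ, μ ℓ := by
  simp [expMatrix, Matrix.mulVec, dotProduct]

/-- Row `k + 1` of `A μ` is `∑_ℓ μ_ℓ w_{ℓ,k}`. [cite: BihanDickenstein2017, §1 eq. (1.2)] -/
theorem expMatrix_mulVec_succ (w : Fin (n + 2) → Fin n → ℤ) (μ : Fin (n + 2) → ℤ) (k : Fin n) :
    (expMatrix w).mulVec μ k.succ = ∑ ℓ, μ ℓ * w ℓ k := by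
  simp [expMatrix, Matrix.mulVec, dotProduct, mul_comm]

/-- An integer affine relation `μ` (`A μ = 0`) gives `∑_ℓ μ_ℓ (w_ℓ − w_a) = 0`.
[cite: BihanDickenstein2017, §2.1 eq. (2.1)] -/
theorem sum_smul_sub_eq_zero (w : Fin (n + 2) → Fin n → ℤ) (μ : Fin (n + 2) → ℤ)
    (hμ : (expMatrix w).mulVec μ = 0) (a : Fin (n + 2)) : ∑ ℓ, μ ℓ • (w ℓ - w a) = 0 := by
  have h0 : ∑ ℓ, μ ℓ = 0 := by rw [← expMatrix_mulVec_zero w μ, hμ, Pi.zero_apply]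
  funext k
  have hk : ∑ ℓ, μ ℓ * w ℓ k = 0 := by rw [← expMatrix_mulVec_succ w μ k, hμ, Pi.zero_apply]
  simp only [Finset.sum_apply, Pi.smul_apply, Pi.sub_apply, smul_eq_mul, mul_sub,
    Finset.sum_sub_distrib, hk, ← Finset.sum_mul, h0, zero_mul, sub_zero, Pi.zero_apply]

/-- `∑_ℓ μ_ℓ u_ℓ = μ_b (w_b − w_a) + ∑_t μ_{e_t} u_t` (the `a`-term vanishes).
[cite: BihanDickenstein2017, §4.2] -/
theorem sum_smul_sub_eq_pair (w : Fin (n + 2) → Fin n → ℤ) (μ : Fin (n + 2) → ℤ) {a b : Fin (n + 2)}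
    (hab : a ≠ b) :
    ∑ ℓ, μ ℓ • (w ℓ - w a) =
      μ b • (w b - w a) + ∑ t, μ (pairCompl hab t) • (w (pairCompl hab t) - w a) := by
  rw [sum_eq_pair_add_sum_pairCompl hab, sub_self, smul_zero, zero_add]

/-- **`U` is nonsingular for a circuit**: a real relation among the `u_t = w_{e_t} − w_a` extends (by
`μ_b = 0`, `μ_a = −∑`) to an affine relation of `𝒜`, which is a multiple of `λ`; as `λ_b ≠ 0` it
vanishes. [cite: BihanDickenstein2017, §2.1 ("`𝒜` is a circuit if `λ_j ≠ 0` for all `j`")] -/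
theorem det_expDiff_ne_zero (w : Fin (n + 2) → Fin n → ℤ) (C : Matrix (Fin n) (Fin (n + 2)) ℝ)
    (hrk : RankCond w C) (hcirc : IsCircuit w) {a b : Fin (n + 2)} (hab : a ≠ b) :
    (expDiff w hab).det ≠ 0 := by
  intro hdet
  obtain ⟨v, hv0, hv⟩ := Matrix.exists_mulVec_eq_zero_iff.mpr hdet
  -- the integer affine relation built from `v`
  set μ : Fin (n + 2) → ℤ :=
    ∑ t, v t • (Pi.single (pairCompl hab t) (1 : ℤ) - Pi.single a 1) with hμdef
  have hμb : μ b = 0 := by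
    simp only [hμdef, Finset.sum_apply, Pi.smul_apply, Pi.sub_apply, smul_eq_mul]
    refine Finset.sum_eq_zero fun t _ => ?_
    rw [Pi.single_eq_of_ne (Ne.symm (pairCompl_ne_right hab t)), Pi.single_eq_of_ne hab.symm,
      sub_zero, mul_zero]
  have hμe : ∀ t, μ (pairCompl hab t) = v t := by
    intro t
    simp only [hμdef, Finset.sum_apply, Pi.smul_apply, Pi.sub_apply, smul_eq_mul,
      Pi.single_eq_of_ne (pairCompl_ne_left hab t), sub_zero]
    rw [Finset.sum_eq_single t]
    · simp
    · intro t' _ ht'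
      rw [Pi.single_eq_of_ne (fun h => ht' ((pairCompl hab).injective h).symm), mul_zero]
    · intro h; exact absurd (Finset.mem_univ t) h
  have hAμ : (expMatrix w).mulVec μ = 0 := by
    funext i
    refine Fin.cases ?_ (fun k => ?_) i
    · rw [expMatrix_mulVec_zero, Pi.zero_apply]
      simp only [hμdef, Finset.sum_apply, Pi.smul_apply, Pi.sub_apply, smul_eq_mul]
      rw [Finset.sum_comm]
      refine Finset.sum_eq_zero fun t _ => ?_
      rw [← Finset.mul_sum, Finset.sum_sub_distrib, Finset.sum_pi_single', Finset.sum_pi_single']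
      simp
    · rw [expMatrix_mulVec_succ, Pi.zero_apply]
      have hvk : (expDiff w hab).mulVec v k = 0 := by rw [hv, Pi.zero_apply]
      rw [Matrix.mulVec, dotProduct] at hvk
      simp only [hμdef, Finset.sum_apply, Pi.smul_apply, Pi.sub_apply, smul_eq_mul,
        Finset.sum_mul]
      rw [Finset.sum_comm, ← hvk]
      refine Finset.sum_congr rfl fun t _ => ?_
      have inner : ∑ ℓ, ((Pi.single (pairCompl hab t) (1 : ℤ) : Fin (n + 2) → ℤ) ℓ - (Pi.single a (1 : ℤ) : Fin (n + 2) → ℤ) ℓ) * w ℓ k =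
          w (pairCompl hab t) k - w a k := by
        simp only [sub_mul, Finset.sum_sub_distrib]
        rw [Finset.sum_eq_single (pairCompl hab t), Finset.sum_eq_single a]
        · simp
        · intro j _ hj; rw [Pi.single_eq_of_ne hj, zero_mul]
        · intro h; exact absurd (Finset.mem_univ _) h
        · intro j _ hj; rw [Pi.single_eq_of_ne hj, zero_mul]
        · intro h; exact absurd (Finset.mem_univ _) h
      calc ∑ ℓ, v t * ((Pi.single (pairCompl hab t) (1 : ℤ) : Fin (n + 2) → ℤ) ℓ - (Pi.single a (1 : ℤ) : Fin (n + 2) → ℤ) ℓ) * w ℓ k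
          = v t * ∑ ℓ, ((Pi.single (pairCompl hab t) (1 : ℤ) : Fin (n + 2) → ℤ) ℓ - (Pi.single a (1 : ℤ) : Fin (n + 2) → ℤ) ℓ) * w ℓ k := by
            rw [Finset.mul_sum]
            exact Finset.sum_congr rfl fun ℓ _ => by ring
        _ = expDiff w hab k t * v t := by
            rw [inner]
            simp only [expDiff, Matrix.of_apply]
            ring
  -- cast to `ℝ` and use `ker A = ℝ λ`
  have hAμR : ((expMatrix w).map (Int.cast : ℤ → ℝ)).mulVec (fun j => (μ j : ℝ)) = 0 := by
    funext i
    have hi := RingHom.map_mulVec (Int.castRingHom ℝ) (expMatrix w) μ i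
    rw [hAμ, Pi.zero_apply, map_zero] at hi
    have e1 : ((expMatrix w).map (Int.cast : ℤ → ℝ)) = (expMatrix w).map (Int.castRingHom ℝ) := by
      ext; simp
    have e2 : (fun j => (μ j : ℝ)) = (Int.castRingHom ℝ) ∘ μ := by ext; simp
    rw [Pi.zero_apply, e1, e2]
    exact hi.symm
  obtain ⟨c, hc⟩ := exists_smul_affRel_of_mulVec_eq_zero w C hrk hcirc _ hAμR
  have hcb := congr_fun hc b
  simp only [Pi.smul_apply, smul_eq_mul, hμb, Int.cast_zero] at hcb
  have hc0 : c = 0 := by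
    rcases mul_eq_zero.mp hcb with h | h
    · exact h
    · exact absurd (by exact_mod_cast h) (hcirc b)
  apply hv0
  funext t
  have := congr_fun hc (pairCompl hab t)
  rw [hc0, Pi.smul_apply, zero_smul, hμe] at this
  exact_mod_cast this.symm

/-- The coefficients `c_{k,t} = det U · adj(U)_{t,k}`, expressing `det(U)² e_k` on the `u_t`.
[cite: BihanSottile2008, Thm. 2.2 (proof)] -/
def adjCoef (w : Fin (n + 2) → Fin n → ℤ) {a b : Fin (n + 2)} (hab : a ≠ b) (k t : Fin n) : ℤ :=
  (expDiff w hab).det * (expDiff w hab).adjugate t k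

/-- `N = det(U)²`. [cite: BihanSottile2008, Thm. 2.2 (proof)] -/
def bigN (w : Fin (n + 2) → Fin n → ℤ) {a b : Fin (n + 2)} (hab : a ≠ b) : ℕ :=
  (expDiff w hab).det.natAbs ^ 2

/-- `N = det(U)²` as an integer. [cite: BihanSottile2008, Thm. 2.2 (proof)] -/
theorem cast_bigN (w : Fin (n + 2) → Fin n → ℤ) {a b : Fin (n + 2)} (hab : a ≠ b) :
    (bigN w hab : ℤ) = (expDiff w hab).det ^ 2 := by
  rw [bigN, Nat.cast_pow, Int.natCast_natAbs, sq_abs]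

/-- `N ≥ 1` for a circuit. [cite: BihanSottile2008, Thm. 2.2 (proof)] -/
theorem bigN_pos (w : Fin (n + 2) → Fin n → ℤ) {a b : Fin (n + 2)} (hab : a ≠ b)
    (hdet : (expDiff w hab).det ≠ 0) : 0 < bigN w hab :=
  pow_pos (Int.natAbs_pos.mpr hdet) 2

/-- (E1) `∑_t c_{k,t} u_t = N e_k`. [cite: BihanSottile2008, Thm. 2.2 (proof)] -/
theorem sum_adjCoef_smul (w : Fin (n + 2) → Fin n → ℤ) {a b : Fin (n + 2)} (hab : a ≠ b) (k : Fin n) :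
    ∑ t, adjCoef w hab k t • (w (pairCompl hab t) - w a) =
      fun k' => if k' = k then (bigN w hab : ℤ) else 0 := by
  have hmul := Matrix.mul_adjugate (expDiff w hab)
  funext k'
  have hkk := congr_fun (congr_fun hmul k') k
  rw [Matrix.mul_apply, Matrix.smul_apply, Matrix.one_apply, smul_eq_mul] at hkk
  simp only [Finset.sum_apply, Pi.smul_apply, smul_eq_mul, adjCoef, cast_bigN]
  have : ∑ t, (expDiff w hab).det * (expDiff w hab).adjugate t k * (w (pairCompl hab t) - w a) k' =
      (expDiff w hab).det * ∑ t, expDiff w hab k' t * (expDiff w hab).adjugate t k := by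
    rw [Finset.mul_sum]
    refine Finset.sum_congr rfl fun t _ => ?_
    simp only [expDiff, Matrix.of_apply, Pi.sub_apply]
    ring
  rw [this, hkk]
  split_ifs <;> ring

/-- (E2) `∑_k (u_t)_k c_{k,t'} = N δ_{t,t'}`. [cite: BihanSottile2008, Thm. 2.2 (proof)] -/
theorem sum_expDiff_mul_adjCoef (w : Fin (n + 2) → Fin n → ℤ) {a b : Fin (n + 2)} (hab : a ≠ b)
    (t t' : Fin n) :
    ∑ k, (w (pairCompl hab t) - w a) k * adjCoef w hab k t' = if t' = t then (bigN w hab : ℤ) else 0 := by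
  have hmul := Matrix.adjugate_mul (expDiff w hab)
  have htt := congr_fun (congr_fun hmul t') t
  rw [Matrix.mul_apply, Matrix.smul_apply, Matrix.one_apply, smul_eq_mul] at htt
  have : ∑ k, (w (pairCompl hab t) - w a) k * adjCoef w hab k t' =
      (expDiff w hab).det * ∑ k, (expDiff w hab).adjugate t' k * expDiff w hab k t := by
    rw [Finset.mul_sum]
    refine Finset.sum_congr rfl fun k _ => ?_
    simp only [adjCoef, expDiff, Matrix.of_apply, Pi.sub_apply]
    ring
  rw [this, htt, cast_bigN]
  split_ifs <;> ring

/-- The coefficients `c'_t = ∑_k v_k c_{k,t}` expressing `N v`, `v = w_b − w_a`, on the `u_t`.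
[cite: BihanSottile2008, Thm. 2.2 (proof)] -/
def adjCoef' (w : Fin (n + 2) → Fin n → ℤ) {a b : Fin (n + 2)} (hab : a ≠ b) (t : Fin n) : ℤ :=
  ∑ k, (w b - w a) k * adjCoef w hab k t

/-- (E3) `∑_t c'_t u_t = N (w_b − w_a)`. [cite: BihanSottile2008, Thm. 2.2 (proof)] -/
theorem sum_adjCoef'_smul (w : Fin (n + 2) → Fin n → ℤ) {a b : Fin (n + 2)} (hab : a ≠ b) :
    ∑ t, adjCoef' w hab t • (w (pairCompl hab t) - w a) = (bigN w hab : ℤ) • (w b - w a) := by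
  have h : ∑ t, adjCoef' w hab t • (w (pairCompl hab t) - w a) =
      ∑ k, (w b - w a) k • ∑ t, adjCoef w hab k t • (w (pairCompl hab t) - w a) := by
    simp only [adjCoef', Finset.smul_sum, smul_smul, Finset.sum_smul]
    rw [Finset.sum_comm]
  rw [h]
  funext k'
  simp only [sum_adjCoef_smul, Finset.sum_apply, Pi.smul_apply, smul_eq_mul, mul_ite, mul_zero,
    Finset.sum_ite_eq, Finset.mem_univ, if_true]
  ring

/-- (E4) For an integer affine relation `μ`: `μ_b c'_t = −N μ_{e_t}` (uniqueness of coordinates on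
the independent `u_t`). [cite: BihanSottile2008, Thm. 2.2 (proof)] -/
theorem mul_adjCoef'_eq (w : Fin (n + 2) → Fin n → ℤ) {a b : Fin (n + 2)} (hab : a ≠ b)
    (hdet : (expDiff w hab).det ≠ 0) (μ : Fin (n + 2) → ℤ) (hμ : (expMatrix w).mulVec μ = 0)
    (t : Fin n) : μ b * adjCoef' w hab t = -((bigN w hab : ℤ) * μ (pairCompl hab t)) := by
  set z : Fin n → ℤ := fun t => μ b * adjCoef' w hab t + (bigN w hab : ℤ) * μ (pairCompl hab t)
    with hz
  have hUz : (expDiff w hab).mulVec z = 0 := by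
    have hvec : ∑ t, z t • (w (pairCompl hab t) - w a) = 0 := by
      simp only [hz, add_smul, Finset.sum_add_distrib, mul_smul]
      rw [← Finset.smul_sum, ← Finset.smul_sum, sum_adjCoef'_smul, smul_smul]
      have hrel := sum_smul_sub_eq_zero w μ hμ a
      rw [sum_smul_sub_eq_pair w μ hab] at hrel
      rw [mul_comm, ← smul_smul, ← smul_add, hrel, smul_zero]
    funext k
    have := congr_fun hvec k
    simp only [Finset.sum_apply, Pi.smul_apply, smul_eq_mul, Pi.zero_apply] at this
    rw [Matrix.mulVec, dotProduct, Pi.zero_apply, ← this]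
    refine Finset.sum_congr rfl fun t _ => ?_
    simp only [expDiff, Matrix.of_apply, Pi.sub_apply]
    ring
  have hz0 := Matrix.eq_zero_of_mulVec_eq_zero hdet hUz
  have := congr_fun hz0 t
  simp only [hz, Pi.zero_apply] at this
  linarith

end Lattice

/-! ### Polynomial identities for `∏ p_ℓ^{μ⁺} − ∏ p_ℓ^{μ⁻}` under a homomorphism -/

section PolyIdentities

variable {n : ℕ} {T' : Type*} [CommRing T']

/-- `↑(P^z) = (↑P)^{z.toNat}` for `z ≥ 0`. [folklore] -/
private theorem val_zpow_toNat (P : T'ˣ) {z : ℤ} (hz : 0 ≤ z) : ((P ^ z : T'ˣ) : T') = (P : T') ^ z.toNat := by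
  rw [← Units.val_pow_eq_pow_val]
  congr 1
  conv_lhs => rw [← Int.toNat_of_nonneg hz]
  exact zpow_natCast _ _

/-- The image of `∏_{μ>0} p_ℓ^{μ_ℓ} − ∏_{μ<0} p_ℓ^{−μ_ℓ}` when the `p_ℓ` go to units `P_ℓ`.
[cite: BihanDickenstein2017, §4.2 (proof of Thm. 2.9)] -/
theorem map_galePoly (φ : ℝ[X] →+* T') (B : Matrix (Fin (n + 2)) (Fin 2) ℝ) (μ : Fin (n + 2) → ℤ)
    (P : Fin (n + 2) → T'ˣ) (hP : ∀ ℓ, φ (linPoly B ℓ) = P ℓ) :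
    φ (galePoly B μ) =
      (↑(∏ ℓ ∈ Finset.univ.filter (fun ℓ => 0 < μ ℓ), P ℓ ^ μ ℓ) : T') -
        ↑(∏ ℓ ∈ Finset.univ.filter (fun ℓ => μ ℓ < 0), P ℓ ^ (-μ ℓ)) := by
  rw [galePoly, map_sub, map_prod, map_prod, Units.coe_prod, Units.coe_prod]
  congr 1
  · refine Finset.prod_congr rfl fun ℓ hℓ => ?_
    rw [map_pow, hP, val_zpow_toNat _ (le_of_lt (Finset.mem_filter.mp hℓ).2)]
  · refine Finset.prod_congr rfl fun ℓ hℓ => ?_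
    rw [map_pow, hP, val_zpow_toNat _ (by have := (Finset.mem_filter.mp hℓ).2; omega)]

/-- `∑_{μ>0} μ_ℓ u_ℓ = ∑_{μ<0} (−μ_ℓ) u_ℓ` when `∑_ℓ μ_ℓ u_ℓ = 0`. [cite: BihanDickenstein2017, §2.1 eq. (2.4)] -/
theorem sum_filter_pos_eq_sum_filter_neg (μ : Fin (n + 2) → ℤ) (u : Fin (n + 2) → Fin n → ℤ)
    (h0 : ∑ ℓ, μ ℓ • u ℓ = 0) :
    ∑ ℓ ∈ Finset.univ.filter (fun ℓ => 0 < μ ℓ), μ ℓ • u ℓ =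
      ∑ ℓ ∈ Finset.univ.filter (fun ℓ => μ ℓ < 0), (-μ ℓ) • u ℓ := by
  rw [Finset.sum_filter, Finset.sum_filter, ← sub_eq_zero, ← Finset.sum_sub_distrib]
  have hterm : ∀ ℓ ∈ (Finset.univ : Finset (Fin (n + 2))),
      ((if 0 < μ ℓ then μ ℓ • u ℓ else 0) - if μ ℓ < 0 then (-μ ℓ) • u ℓ else 0) = μ ℓ • u ℓ := by
    intro ℓ _
    by_cases h1 : 0 < μ ℓ
    · have h2 : ¬ μ ℓ < 0 := by omega
      simp [h1, h2]
    · by_cases h2 : μ ℓ < 0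
      · simp [h1, h2]
      · have h3 : μ ℓ = 0 := by omega
        simp [h3]
  rw [Finset.sum_congr rfl hterm]
  exact h0

/-- **`Θ(G) ∈ J`-type vanishing**: if the `p_ℓ` go to monomials `ζ^{w_ℓ − w_a}` then
`∏ p_ℓ^{μ⁺} − ∏ p_ℓ^{μ⁻}` goes to `0`, for any integer affine relation `μ` (`A μ = 0`).
[cite: BihanSottile2008, Thm. 2.2 (proof)] -/
theorem map_galePoly_eq_zero (φ : ℝ[X] →+* T') (B : Matrix (Fin (n + 2)) (Fin 2) ℝ)
    (w : Fin (n + 2) → Fin n → ℤ) (a : Fin (n + 2)) (μ : Fin (n + 2) → ℤ)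
    (hμ : (expMatrix w).mulVec μ = 0) (ζ : Fin n → T'ˣ)
    (hP : ∀ ℓ, φ (linPoly B ℓ) = ↑(umon ζ (w ℓ - w a))) : φ (galePoly B μ) = 0 := by
  rw [map_galePoly φ B μ (fun ℓ => umon ζ (w ℓ - w a)) hP, sub_eq_zero]
  congr 1
  rw [← umon_sum_zsmul, ← umon_sum_zsmul,
    sum_filter_pos_eq_sum_filter_neg μ (fun ℓ => w ℓ - w a) (sum_smul_sub_eq_zero w μ hμ a)]

/-- Conversely, if `∏ p_ℓ^{μ⁺} − ∏ p_ℓ^{μ⁻}` goes to `0` and the `p_ℓ` go to units `P_ℓ`, then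
`∏_ℓ P_ℓ^{μ_ℓ} = 1` ("`g ≡ 1`"). [cite: BihanDickenstein2017, §4.2 (proof of Thm. 2.9)] -/
theorem prod_zpow_eq_one_of_map_galePoly (φ : ℝ[X] →+* T') (B : Matrix (Fin (n + 2)) (Fin 2) ℝ)
    (μ : Fin (n + 2) → ℤ) (P : Fin (n + 2) → T'ˣ) (hP : ∀ ℓ, φ (linPoly B ℓ) = P ℓ)
    (h0 : φ (galePoly B μ) = 0) : ∏ ℓ, P ℓ ^ μ ℓ = 1 := by
  rw [map_galePoly φ B μ P hP, sub_eq_zero, Units.val_inj] at h0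
  have hsplit : ∏ ℓ, P ℓ ^ μ ℓ =
      (∏ ℓ ∈ Finset.univ.filter (fun ℓ => 0 < μ ℓ), P ℓ ^ μ ℓ) *
        ∏ ℓ ∈ Finset.univ.filter (fun ℓ => μ ℓ < 0), P ℓ ^ μ ℓ := by
    rw [Finset.prod_filter, Finset.prod_filter, ← Finset.prod_mul_distrib]
    refine Finset.prod_congr rfl fun ℓ _ => ?_
    by_cases h1 : 0 < μ ℓ
    · have h2 : ¬ μ ℓ < 0 := by omega
      simp [h1, h2]
    · by_cases h2 : μ ℓ < 0
      · simp [h1, h2]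
      · have h3 : μ ℓ = 0 := by omega
        simp [h3]
  rw [hsplit, h0, ← Finset.prod_mul_distrib]
  refine Finset.prod_eq_one fun ℓ _ => ?_
  rw [← _root_.zpow_add, neg_add_cancel, zpow_zero]

/-- `∏_ℓ f(ℓ) = f(a) f(b) ∏_t f(e_t)`. [cite: BihanDickenstein2017, §2.2] -/
theorem prod_eq_pair_mul_prod_pairCompl {M : Type*} [CommMonoid M] {a b : Fin (n + 2)}
    (hab : a ≠ b) (f : Fin (n + 2) → M) :
    ∏ ℓ, f ℓ = f a * f b * ∏ t, f (pairCompl hab t) := by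
  rw [← Finset.prod_sdiff (Finset.subset_univ ({a, b} : Finset (Fin (n + 2)))),
    Finset.prod_pair hab, mul_comm]
  congr 1
  rw [← Finset.map_orderEmbOfFin_univ _ (card_univ_sdiff_pair hab), Finset.prod_map]
  rfl

/-- `p_a = 1` for the normalized basis (`P_a = (1, 0)`). [cite: BihanDickenstein2017, §4.2 (proof of Thm. 2.9)] -/
theorem linPoly_left {C : Matrix (Fin n) (Fin (n + 2)) ℝ} {a b : Fin (n + 2)}
    {B : Matrix (Fin (n + 2)) (Fin 2) ℝ} (hB : IsNormalizedGaleBasis C a b B) : linPoly B a = 1 := by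
  simp [linPoly, hB.left_fst, hB.left_snd]

/-- `p_b = Y` for the normalized basis (`P_b = (0, 1)`). [cite: BihanDickenstein2017, §4.2 (proof of Thm. 2.9)] -/
theorem linPoly_right {C : Matrix (Fin n) (Fin (n + 2)) ℝ} {a b : Fin (n + 2)}
    {B : Matrix (Fin (n + 2)) (Fin 2) ℝ} (hB : IsNormalizedGaleBasis C a b B) : linPoly B b = X := by
  simp [linPoly, hB.right_fst, hB.right_snd]

/-- `z^k = 1` for an integer `k` forces `z^{|k|} = 1`. [folklore] -/
private theorem pow_natAbs_eq_one_of_zpow_eq_one {G : Type*} [Group G] (z : G) (k : ℤ) (hk : z ^ k = 1) :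
    z ^ k.natAbs = 1 := by
  rcases Int.natAbs_eq k with h | h
  · rw [← zpow_natCast, ← h, hk]
  · have : z ^ (-(k.natAbs : ℤ)) = 1 := by rw [← h, hk]
    rwa [_root_.zpow_neg, inv_eq_one, zpow_natCast] at this

end PolyIdentities

/-! ### The positive point as units of `ℝ` -/

section RealUnits

variable {n : ℕ}

/-- The coordinates of a point with nonzero coordinates, as units of `ℝ`. [folklore] -/
def xUnit (x : Fin n → ℝ) (hx : ∀ k, x k ≠ 0) (k : Fin n) : ℝˣ := Units.mk0 (x k) (hx k)

/-- `x^u` as a unit of `ℝ`. [cite: BihanDickenstein2017, §1 eq. (1.1)] -/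
theorem monomial_eq_umon (x : Fin n → ℝ) (hx : ∀ k, x k ≠ 0) (u : Fin n → ℤ) :
    monomial u x = ↑(umon (xUnit x hx) u) := by
  simp [monomial, umon, xUnit, Units.val_zpow_eq_zpow_val]

/-- `x^{∑ c_i u_i} = ∏ (x^{u_i})^{c_i}`. [cite: BihanDickenstein2017, §1 eq. (1.1)] -/
theorem monomial_sum_zsmul (x : Fin n → ℝ) (hx : ∀ k, x k ≠ 0) {ι : Type*} (s : Finset ι)
    (c : ι → ℤ) (u : ι → Fin n → ℤ) :
    monomial (∑ i ∈ s, c i • u i) x = ∏ i ∈ s, monomial (u i) x ^ c i := by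
  rw [monomial_eq_umon x hx, umon_sum_zsmul, Units.coe_prod]
  refine Finset.prod_congr rfl fun i _ => ?_
  rw [Units.val_zpow_eq_zpow_val, ← monomial_eq_umon x hx]

/-- `x^{c u} = (x^u)^c`. [cite: BihanDickenstein2017, §1 eq. (1.1)] -/
theorem monomial_zsmul (x : Fin n → ℝ) (hx : ∀ k, x k ≠ 0) (c : ℤ) (u : Fin n → ℤ) :
    monomial (c • u) x = monomial u x ^ c := by
  rw [monomial_eq_umon x hx, umon_zsmul, Units.val_zpow_eq_zpow_val, ← monomial_eq_umon x hx]

end RealUnits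

/-! ### The core: `ℝ[X]_{𝔪_x}/(f) ≃ ℝ[Y]/((Y − y₀)^m)` -/

namespace GaleLocalData

variable {n : ℕ} {w : Fin (n + 2) → Fin n → ℤ} {C : Matrix (Fin n) (Fin (n + 2)) ℝ}
  {a b : Fin (n + 2)} {B : Matrix (Fin (n + 2)) (Fin 2) ℝ} {x : Fin n → ℝ}

/-- `y₀ = x^{w_b − w_a}`, the point of `Δ_P` corresponding to the solution `x`
("`y = x^{w_{ᾱ_j}}`" after the translation `w_{ᾱ_i} = 0`). [cite: BihanDickenstein2017, §4.2] -/
def yPt (w : Fin (n + 2) → Fin n → ℤ) (a b : Fin (n + 2)) (x : Fin n → ℝ) : ℝ :=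
  monomial (w b - w a) x

/-- The local ideal `J = (f_1, …, f_n) ℝ[X]_{𝔪_x}` of `BD17.solMultiplicity`.
[cite: BihanDickenstein2017, §1 (after eq. (1.1))] -/
def locIdeal (w : Fin (n + 2) → Fin n → ℤ) (C : Matrix (Fin n) (Fin (n + 2)) ℝ) (x : Fin n → ℝ) :
    Ideal (Localization.AtPrime (pointIdeal x)) :=
  (systemIdeal w C).map (algebraMap (MvPolynomial (Fin n) ℝ) (Localization.AtPrime (pointIdeal x)))

/-- `BD17.solMultiplicity w C x = dim_ℝ ℝ[X]_{𝔪_x}/J` (unfolding). [cite: BihanDickenstein2017, §1 (after eq. (1.1))] -/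
theorem solMultiplicity_eq_finrank (w : Fin (n + 2) → Fin n → ℤ) (C : Matrix (Fin n) (Fin (n + 2)) ℝ)
    (x : Fin n → ℝ) :
    solMultiplicity w C x =
      Module.finrank ℝ (Localization.AtPrime (pointIdeal x) ⧸ locIdeal w C x) := by
  unfold solMultiplicity locIdeal
  rfl

/-- Evaluation at `x` on the local algebra `ℝ[X]_{𝔪_x}/(f)` (`x` is a solution).
[cite: BihanSottile2008, §3 ("real points with residue field ℝ")] -/
def quotEval (h : GaleLocalData w C a b B x) :
    (Localization.AtPrime (pointIdeal x) ⧸ locIdeal w C x) →ₐ[ℝ] ℝ :=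
  Ideal.Quotient.liftₐ (locIdeal w C x) (locEval x) (fun o ho =>
    map_systemIdeal_le_ker h.basis x h.ne_zero (locEval x) (fun ℓ => by
      simp only [hgen, map_sub, map_smul, locEval_locMon, smul_eq_mul, h.monomial_eq ℓ]
      ring) ho)

/-- Evaluation at `x` of a class is evaluation of a representative. [cite: BihanSottile2008, §3] -/
theorem quotEval_mk (h : GaleLocalData w C a b B x) (o : Localization.AtPrime (pointIdeal x)) :
    h.quotEval (Ideal.Quotient.mk (locIdeal w C x) o) = locEval x o := by
  rw [quotEval, Ideal.Quotient.liftₐ_apply, Ideal.Quotient.lift_mk]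
  rfl

/-- Units of the local algebra are detected by evaluation at `x`. [cite: BihanSottile2008, §3] -/
theorem isUnit_of_quotEval_ne_zero (h : GaleLocalData w C a b B x)
    (β : Localization.AtPrime (pointIdeal x) ⧸ locIdeal w C x) (hβ : h.quotEval β ≠ 0) : IsUnit β := by
  obtain ⟨o, rfl⟩ := Ideal.Quotient.mk_surjective β
  rw [quotEval_mk] at hβ
  exact ((isUnit_iff_locEval_ne_zero x o).mpr hβ).map _

/-- The variables `X_k` as units of the local algebra. [cite: BihanSottile2008, §1] -/
def quotX (h : GaleLocalData w C a b B x) (k : Fin n) : (Localization.AtPrime (pointIdeal x) ⧸ locIdeal w C x)ˣ where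
  val := Ideal.Quotient.mk (locIdeal w C x) (locXUnit x h.ne_zero k : Localization.AtPrime (pointIdeal x))
  inv := Ideal.Quotient.mk (locIdeal w C x) (↑(locXUnit x h.ne_zero k)⁻¹ : Localization.AtPrime (pointIdeal x))
  val_inv := by rw [← map_mul, Units.mul_inv, map_one]
  inv_val := by rw [← map_mul, Units.inv_mul, map_one]

/-- The class of `X^u` in the local algebra. [cite: BihanSottile2008, §1] -/
theorem val_umon_quotX (h : GaleLocalData w C a b B x) (u : Fin n → ℤ) :
    ((umon (T := Localization.AtPrime (pointIdeal x) ⧸ locIdeal w C x) h.quotX u : (Localization.AtPrime (pointIdeal x) ⧸ locIdeal w C x)ˣ) : Localization.AtPrime (pointIdeal x) ⧸ locIdeal w C x) =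
      Ideal.Quotient.mk (locIdeal w C x) (locMon x h.ne_zero u : Localization.AtPrime (pointIdeal x)) :=
  (map_val_umon (T' := Localization.AtPrime (pointIdeal x) ⧸ locIdeal w C x) (Ideal.Quotient.mk (locIdeal w C x)) (locXUnit x h.ne_zero) h.quotX
    (fun _ => rfl) u).symm

/-- `X^u(x) = x^u` in the local algebra. [cite: BihanSottile2008, Thm. 2.2 (proof)] -/
private theorem quotEval_umon_quotX (h : GaleLocalData w C a b B x) (u : Fin n → ℤ) :
    h.quotEval ((umon (T := Localization.AtPrime (pointIdeal x) ⧸ locIdeal w C x) h.quotX u : (Localization.AtPrime (pointIdeal x) ⧸ locIdeal w C x)ˣ) : Localization.AtPrime (pointIdeal x) ⧸ locIdeal w C x) = monomial u x := by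
  rw [val_umon_quotX, quotEval_mk, locEval_locMon]

/-- **The monomials satisfy the Gale relations in the local algebra**: `X^{w_ℓ − w_a} = p_ℓ(X^{v})`,
`v = w_b − w_a` (from `h_ℓ ∈ J`). [cite: BihanSottile2008, Thm. 2.2 (proof)] -/
theorem mk_aeval_linPoly (h : GaleLocalData w C a b B x) (ℓ : Fin (n + 2)) :
    Ideal.Quotient.mk (locIdeal w C x)
      (aeval (locMon x h.ne_zero (w b - w a) : Localization.AtPrime (pointIdeal x)) (linPoly B ℓ)) =
      ((umon (T := Localization.AtPrime (pointIdeal x) ⧸ locIdeal w C x) h.quotX (w ℓ - w a) : (Localization.AtPrime (pointIdeal x) ⧸ locIdeal w C x)ˣ) : Localization.AtPrime (pointIdeal x) ⧸ locIdeal w C x) := by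
  have hJ : Ideal.Quotient.mk (locIdeal w C x) (hgen w B a b x h.ne_zero ℓ) = 0 :=
    Ideal.Quotient.eq_zero_iff_mem.mpr (hgen_mem_map_systemIdeal h ℓ)
  set π := Ideal.Quotient.mk (locIdeal w C x) with hπ
  have hJ' : π (locMon x h.ne_zero (w ℓ) : Localization.AtPrime (pointIdeal x)) =
      π (algebraMap ℝ _ (B ℓ 0)) * π (locMon x h.ne_zero (w a) : Localization.AtPrime (pointIdeal x)) +
        π (algebraMap ℝ _ (B ℓ 1)) * π (locMon x h.ne_zero (w b) : Localization.AtPrime (pointIdeal x)) := by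
    rw [hgen, map_sub, map_sub, sub_sub, sub_eq_zero] at hJ
    rw [hJ, Algebra.smul_def, Algebra.smul_def, map_mul, map_mul]
  have e1 : aeval (locMon x h.ne_zero (w b - w a) : Localization.AtPrime (pointIdeal x)) (linPoly B ℓ) =
      algebraMap ℝ _ (B ℓ 0) + algebraMap ℝ _ (B ℓ 1) *
        (locMon x h.ne_zero (w b - w a) : Localization.AtPrime (pointIdeal x)) := by
    rw [linPoly, map_add, map_mul, aeval_C, aeval_C, aeval_X]
  have e2 : (locMon x h.ne_zero (w ℓ - w a) : Localization.AtPrime (pointIdeal x)) =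
      (locMon x h.ne_zero (w ℓ) : Localization.AtPrime (pointIdeal x)) *
        ↑(locMon x h.ne_zero (w a))⁻¹ := by
    rw [locMon, locMon, locMon, umon_sub, Units.val_mul]
  have e3 : (locMon x h.ne_zero (w b - w a) : Localization.AtPrime (pointIdeal x)) =
      (locMon x h.ne_zero (w b) : Localization.AtPrime (pointIdeal x)) *
        ↑(locMon x h.ne_zero (w a))⁻¹ := by
    rw [locMon, locMon, locMon, umon_sub, Units.val_mul]
  have hu : π (locMon x h.ne_zero (w a) : Localization.AtPrime (pointIdeal x)) *
      π ↑(locMon x h.ne_zero (w a))⁻¹ = 1 := by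
    rw [← map_mul, Units.mul_inv, map_one]
  rw [val_umon_quotX, ← hπ, e1, e2, e3, map_add, map_mul, map_mul, map_mul, hJ']
  linear_combination (-(π (algebraMap ℝ (Localization.AtPrime (pointIdeal x)) (B ℓ 0)))) * hu

/-- **`Θ(G) ∈ J`**: `∏ p_ℓ(X^v)^{μ⁺} − ∏ p_ℓ(X^v)^{μ⁻} = X^{∑⁺} − X^{∑⁻} = 0` in the local algebra.
[cite: BihanSottile2008, Thm. 2.2 (proof)] -/
theorem mk_aeval_galePoly (h : GaleLocalData w C a b B x) (μ : Fin (n + 2) → ℤ)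
    (hμ : (expMatrix w).mulVec μ = 0) :
    Ideal.Quotient.mk (locIdeal w C x)
      (aeval (locMon x h.ne_zero (w b - w a) : Localization.AtPrime (pointIdeal x)) (galePoly B μ)) = 0 := by
  have := map_galePoly_eq_zero (T' := Localization.AtPrime (pointIdeal x) ⧸ locIdeal w C x)
    ((Ideal.Quotient.mk (locIdeal w C x)).comp
      (aeval (locMon x h.ne_zero (w b - w a) : Localization.AtPrime (pointIdeal x))).toRingHom)
    B w a μ hμ h.quotX (fun ℓ => by
      rw [RingHom.comp_apply]
      exact h.mk_aeval_linPoly ℓ)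
  exact this

/-- `G(y₀) = 0`: `y₀` is a root of `∏ p_ℓ^{μ⁺} − ∏ p_ℓ^{μ⁻}`. [cite: BihanDickenstein2017, §4.2] -/
theorem eval_galePoly_yPt (h : GaleLocalData w C a b B x) (μ : Fin (n + 2) → ℤ)
    (hμ : (expMatrix w).mulVec μ = 0) : (galePoly B μ).eval (yPt w a b x) = 0 := by
  have := map_galePoly_eq_zero (evalRingHom (yPt w a b x)) B w a μ hμ (xUnit x h.ne_zero)
    (fun ℓ => by
      rw [coe_evalRingHom, eval_linPoly, yPt, ← h.monomial_sub_eq_galeLin ℓ, monomial_eq_umon])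
  exact this

/-- `y₀ > 0`. [cite: BihanDickenstein2017, §4.2 (proof of Thm. 2.9)] -/
theorem yPt_pos (h : GaleLocalData w C a b B x) : 0 < yPt w a b x := monomial_pos _ h.pos

/-- The multiplicity `m` of `y₀` as a root of `∏ p_ℓ^{μ⁺} − ∏ p_ℓ^{μ⁻}`.
[cite: BihanDickenstein2017, §4.2 (proof of Thm. 2.9)] -/
def mult (w : Fin (n + 2) → Fin n → ℤ) (a b : Fin (n + 2)) (B : Matrix (Fin (n + 2)) (Fin 2) ℝ)
    (μ : Fin (n + 2) → ℤ) (x : Fin n → ℝ) : ℕ :=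
  (galePoly B μ).rootMultiplicity (yPt w a b x)

/-- `m ≥ 1`: `y₀` is a root (when `G ≠ 0`). [cite: BihanDickenstein2017, §4.2 (proof of Thm. 2.9)] -/
theorem mult_pos (h : GaleLocalData w C a b B x) (μ : Fin (n + 2) → ℤ)
    (hμ : (expMatrix w).mulVec μ = 0) (hG : galePoly B μ ≠ 0) : 0 < mult w a b B μ x :=
  (rootMultiplicity_pos hG).mpr (h.eval_galePoly_yPt μ hμ)

/-! #### `Φ : ℝ[Y]/((Y − y₀)^m) → ℝ[X]_{𝔪_x}/(f)`, `Y ↦ X^{w_b − w_a}` -/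

/-- `Φ`: the class of `Y` goes to the class of `X^{w_b − w_a}`; well defined because
`G = (Y − y₀)^m H` with `H(y₀) ≠ 0` goes to `0` and `H` goes to a unit.
[cite: BihanSottile2008, Thm. 2.2 (proof)] -/
def phi (h : GaleLocalData w C a b B x) (μ : Fin (n + 2) → ℤ) (hμ : (expMatrix w).mulVec μ = 0)
    (hG : galePoly B μ ≠ 0) :
    AdjoinRoot ((X - Polynomial.C (yPt w a b x)) ^ mult w a b B μ x) →ₐ[ℝ]
      (Localization.AtPrime (pointIdeal x) ⧸ locIdeal w C x) :=
  AdjoinRoot.liftAlgHom _ (Algebra.ofId ℝ _)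
    (Ideal.Quotient.mk (locIdeal w C x)
      (locMon x h.ne_zero (w b - w a) : Localization.AtPrime (pointIdeal x))) (by
    set o := (locMon x h.ne_zero (w b - w a) : Localization.AtPrime (pointIdeal x)) with ho
    set π := Ideal.Quotient.mkₐ ℝ (locIdeal w C x) with hπ
    have hfac := pow_mul_divByMonic_rootMultiplicity_eq (galePoly B μ) (yPt w a b x)
    set H := galePoly B μ /ₘ (X - Polynomial.C (yPt w a b x)) ^ (galePoly B μ).rootMultiplicity (yPt w a b x)
      with hH
    have hHev : H.eval (yPt w a b x) ≠ 0 := eval_divByMonic_pow_rootMultiplicity_ne_zero _ hG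
    have heq : ∀ q : ℝ[X], eval₂ ((Algebra.ofId ℝ (Localization.AtPrime (pointIdeal x) ⧸ locIdeal w C x) : ℝ →ₐ[ℝ] Localization.AtPrime (pointIdeal x) ⧸ locIdeal w C x) : ℝ →+* Localization.AtPrime (pointIdeal x) ⧸ locIdeal w C x)
        (Ideal.Quotient.mk (locIdeal w C x) o) q = π (aeval o q) := by
      intro q
      rw [hπ, Ideal.Quotient.mkₐ_eq_mk, aeval_def, hom_eval₂]
      congr 1
    rw [heq]
    have hG0 : π (aeval o (galePoly B μ)) = 0 := h.mk_aeval_galePoly μ hμ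
    rw [← hfac, map_mul, map_mul] at hG0
    have hunit : IsUnit (π (aeval o H)) := by
      apply h.isUnit_of_quotEval_ne_zero
      rw [hπ, Ideal.Quotient.mkₐ_eq_mk, quotEval_mk, ← aeval_algHom_apply, locEval_locMon]
      rwa [coe_aeval_eq_eval, ← yPt]
    exact (hunit.mul_left_eq_zero).mp hG0)

/-- `Φ(Ȳ) = X^{w_b − w_a}`. [cite: BihanSottile2008, Thm. 2.2 (proof)] -/
private theorem phi_root (h : GaleLocalData w C a b B x) (μ : Fin (n + 2) → ℤ)
    (hμ : (expMatrix w).mulVec μ = 0) (hG : galePoly B μ ≠ 0) :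
    h.phi μ hμ hG (AdjoinRoot.root _) =
      Ideal.Quotient.mk (locIdeal w C x)
        (locMon x h.ne_zero (w b - w a) : Localization.AtPrime (pointIdeal x)) := by
  rw [phi, AdjoinRoot.liftAlgHom_root]

/-- `Φ(q̄) = q(X^{w_b − w_a})`. [cite: BihanSottile2008, Thm. 2.2 (proof)] -/
private theorem phi_mk (h : GaleLocalData w C a b B x) (μ : Fin (n + 2) → ℤ)
    (hμ : (expMatrix w).mulVec μ = 0) (hG : galePoly B μ ≠ 0) (q : ℝ[X]) :
    h.phi μ hμ hG (AdjoinRoot.mk _ q) =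
      Ideal.Quotient.mk (locIdeal w C x)
        (aeval (locMon x h.ne_zero (w b - w a) : Localization.AtPrime (pointIdeal x)) q) := by
  rw [← AdjoinRoot.aeval_eq, ← aeval_algHom_apply, phi_root,
    show Ideal.Quotient.mk (locIdeal w C x) (locMon x h.ne_zero (w b - w a) :
      Localization.AtPrime (pointIdeal x)) = Ideal.Quotient.mkₐ ℝ (locIdeal w C x)
        (locMon x h.ne_zero (w b - w a) : Localization.AtPrime (pointIdeal x)) from rfl,
    aeval_algHom_apply]
  rfl

/-- `quotEval ∘ Φ = truncRes`. [cite: BihanSottile2008, Thm. 2.2 (proof)] -/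
theorem quotEval_comp_phi (h : GaleLocalData w C a b B x) (μ : Fin (n + 2) → ℤ)
    (hμ : (expMatrix w).mulVec μ = 0) (hG : galePoly B μ ≠ 0) :
    h.quotEval.comp (h.phi μ hμ hG) = truncRes (yPt w a b x) (mult w a b B μ x) (h.mult_pos μ hμ hG) := by
  apply AdjoinRoot.algHom_ext
  rw [AlgHom.comp_apply, phi_root, quotEval_mk, locEval_locMon, truncRes_root]
  rfl

end GaleLocalData

namespace GaleLocalData

variable {n : ℕ} {w : Fin (n + 2) → Fin n → ℤ} {C : Matrix (Fin n) (Fin (n + 2)) ℝ}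
  {a b : Fin (n + 2)} {B : Matrix (Fin (n + 2)) (Fin 2) ℝ} {x : Fin n → ℝ}

/-! #### The units `p̄_ℓ` of `ℝ[Y]/((Y − y₀)^m)` and the `N`-th roots `ρ_k` -/

section Psi

variable (h : GaleLocalData w C a b B x) (μ : Fin (n + 2) → ℤ) (hμ : (expMatrix w).mulVec μ = 0)
  (hG : galePoly B μ ≠ 0)
include h hμ hG

/-- The residue of `p̄_ℓ` is `x^{w_ℓ − w_a}`. [cite: BihanSottile2008, Thm. 2.2 (proof)] -/
private theorem truncRes_mk_linPoly (ℓ : Fin (n + 2)) :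
    truncRes (yPt w a b x) (mult w a b B μ x) (h.mult_pos μ hμ hG) (AdjoinRoot.mk _ (linPoly B ℓ)) =
      monomial (w ℓ - w a) x := by
  rw [truncRes_mk, eval_linPoly, yPt, h.monomial_sub_eq_galeLin ℓ]

/-- `p̄_ℓ = p_ℓ(Y) mod (Y − y₀)^m`, a unit (its residue `p_ℓ(y₀) = x^{w_ℓ − w_a}` is positive).
[cite: BihanSottile2008, Thm. 2.2 (proof)] -/
def truncP (ℓ : Fin (n + 2)) : (AdjoinRoot ((X - Polynomial.C (yPt w a b x)) ^ mult w a b B μ x))ˣ :=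
  (isUnit_of_truncRes_ne_zero (h.mult_pos μ hμ hG) (AdjoinRoot.mk _ (linPoly B ℓ)) (by
    rw [h.truncRes_mk_linPoly μ hμ hG]
    exact (monomial_pos _ h.pos).ne')).unit

/-- `p̄_ℓ` is the class of `p_ℓ`. [cite: BihanSottile2008, Thm. 2.2 (proof)] -/
private theorem val_truncP (ℓ : Fin (n + 2)) :
    (h.truncP μ hμ hG ℓ : AdjoinRoot ((X - Polynomial.C (yPt w a b x)) ^ mult w a b B μ x)) = AdjoinRoot.mk _ (linPoly B ℓ) :=
  IsUnit.unit_spec _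

/-- The residue of `p̄_ℓ` is `x^{w_ℓ − w_a}`. [cite: BihanSottile2008, Thm. 2.2 (proof)] -/
private theorem truncRes_truncP (ℓ : Fin (n + 2)) :
    truncRes (yPt w a b x) (mult w a b B μ x) (h.mult_pos μ hμ hG) (h.truncP μ hμ hG ℓ : AdjoinRoot ((X - Polynomial.C (yPt w a b x)) ^ mult w a b B μ x)) =
      monomial (w ℓ - w a) x := by
  rw [val_truncP, h.truncRes_mk_linPoly μ hμ hG]

/-- `p̄_a = 1`. [cite: BihanSottile2008, Thm. 2.2 (proof)] -/
private theorem truncP_left : h.truncP μ hμ hG a = 1 := by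
  apply Units.ext
  rw [val_truncP, linPoly_left h.basis, map_one, Units.val_one]

/-- `p̄_b = Ȳ`. [cite: BihanSottile2008, Thm. 2.2 (proof)] -/
private theorem val_truncP_right : (h.truncP μ hμ hG b : AdjoinRoot ((X - Polynomial.C (yPt w a b x)) ^ mult w a b B μ x)) = AdjoinRoot.root _ := by
  rw [val_truncP, linPoly_right h.basis, AdjoinRoot.mk_X]

/-- `∏_ℓ p̄_ℓ^{μ_ℓ} = 1` in `ℝ[Y]/((Y − y₀)^m)` (because `(Y − y₀)^m ∣ G`).
[cite: BihanDickenstein2017, §4.2 (proof of Thm. 2.9)] -/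
theorem prod_truncP_zpow : ∏ ℓ, h.truncP μ hμ hG ℓ ^ μ ℓ = 1 :=
  prod_zpow_eq_one_of_map_galePoly (AdjoinRoot.mk _) B μ (h.truncP μ hμ hG)
    (fun ℓ => (h.val_truncP μ hμ hG ℓ).symm)
    (AdjoinRoot.mk_eq_zero.mpr (pow_rootMultiplicity_dvd _ _))

/-- `∏_t p̄_{e_t}^{μ_{e_t}} = p̄_b^{−μ_b}`. [cite: BihanDickenstein2017, §4.2 (proof of Thm. 2.9)] -/
theorem umon_truncP_rel :
    umon (T := AdjoinRoot ((X - Polynomial.C (yPt w a b x)) ^ mult w a b B μ x)) (fun t => h.truncP μ hμ hG (pairCompl h.ne t)) (fun t => μ (pairCompl h.ne t)) =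
      h.truncP μ hμ hG b ^ (-μ b) := by
  have hprod := h.prod_truncP_zpow μ hμ hG
  rw [prod_eq_pair_mul_prod_pairCompl h.ne, h.truncP_left μ hμ hG, _root_.one_zpow, one_mul] at hprod
  rw [_root_.zpow_neg, eq_inv_iff_mul_eq_one, mul_comm]
  exact hprod

/-- The residue of a monomial in the `p̄_{e_t}`. [cite: BihanSottile2008, Thm. 2.2 (proof)] -/
theorem truncRes_umon_truncP (c : Fin n → ℤ) :
    truncRes (yPt w a b x) (mult w a b B μ x) (h.mult_pos μ hμ hG)
      (umon (T := AdjoinRoot ((X - Polynomial.C (yPt w a b x)) ^ mult w a b B μ x)) (fun t => h.truncP μ hμ hG (pairCompl h.ne t)) c : AdjoinRoot ((X - Polynomial.C (yPt w a b x)) ^ mult w a b B μ x)) =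
      monomial (∑ t, c t • (w (pairCompl h.ne t) - w a)) x := by
  rw [residue_umon_alg, monomial_sum_zsmul x h.ne_zero]
  exact Finset.prod_congr rfl fun t _ => by rw [h.truncRes_truncP μ hμ hG]

/-- `q̄_k = ∏_t p̄_{e_t}^{c_{k,t}}`, whose residue is `x_k^N`. [cite: BihanSottile2008, Thm. 2.2 (proof)] -/
def qU (k : Fin n) : (AdjoinRoot ((X - Polynomial.C (yPt w a b x)) ^ mult w a b B μ x))ˣ :=
  umon (T := AdjoinRoot ((X - Polynomial.C (yPt w a b x)) ^ mult w a b B μ x)) (fun t => h.truncP μ hμ hG (pairCompl h.ne t)) (fun t => adjCoef w h.ne k t)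

/-- The residue of `q̄_k` is `x_k^N`. [cite: BihanSottile2008, Thm. 2.2 (proof)] -/
private theorem truncRes_qU (k : Fin n) :
    truncRes (yPt w a b x) (mult w a b B μ x) (h.mult_pos μ hμ hG) (h.qU μ hμ hG k : AdjoinRoot ((X - Polynomial.C (yPt w a b x)) ^ mult w a b B μ x)) =
      x k ^ bigN w h.ne := by
  rw [qU, h.truncRes_umon_truncP μ hμ hG, sum_adjCoef_smul]
  rw [show (fun k' => if k' = k then (bigN w h.ne : ℤ) else 0) =
      ((bigN w h.ne : ℤ) • fun k' => if k' = k then (1 : ℤ) else 0) by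
    funext k'; by_cases hk : k' = k <;> simp [hk]]
  rw [monomial_zsmul x h.ne_zero, zpow_natCast]
  congr 1
  rw [monomial, Finset.prod_eq_single k]
  · simp
  · intro k' _ hk'; simp [hk']
  · intro hk; exact absurd (Finset.mem_univ k) hk

/-- Existence of the Hensel root `ρ_k`. [cite: BihanSottile2008, Thm. 2.2 (proof)] -/
private theorem exists_rho (k : Fin n) :
    ∃ ρ : AdjoinRoot ((X - Polynomial.C (yPt w a b x)) ^ mult w a b B μ x), ρ ^ bigN w h.ne = (h.qU μ hμ hG k : AdjoinRoot ((X - Polynomial.C (yPt w a b x)) ^ mult w a b B μ x)) ∧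
      truncRes (yPt w a b x) (mult w a b B μ x) (h.mult_pos μ hμ hG) ρ = x k :=
  exists_pow_eq_of_truncRes (h.mult_pos μ hμ hG)
    (bigN_pos w h.ne (det_expDiff_ne_zero w C h.rank h.circuit h.ne)) _ (x k) (h.ne_zero k)
    (h.truncRes_qU μ hμ hG k)

/-- **The Hensel roots** `ρ_k`: `ρ_k^N = q̄_k`, `ρ_k ≡ x_k`; `ρ_k` is where `X_k` goes under `Ψ`.
[cite: BihanSottile2008, Thm. 2.2 (proof)] -/
def rho (k : Fin n) : AdjoinRoot ((X - Polynomial.C (yPt w a b x)) ^ mult w a b B μ x) := Classical.choose (h.exists_rho μ hμ hG k)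

/-- `ρ_k^N = q̄_k`. [cite: BihanSottile2008, Thm. 2.2 (proof)] -/
private theorem rho_pow (k : Fin n) : h.rho μ hμ hG k ^ bigN w h.ne = h.qU μ hμ hG k :=
  (Classical.choose_spec (h.exists_rho μ hμ hG k)).1

/-- `ρ_k ≡ x_k`. [cite: BihanSottile2008, Thm. 2.2 (proof)] -/
private theorem truncRes_rho (k : Fin n) :
    truncRes (yPt w a b x) (mult w a b B μ x) (h.mult_pos μ hμ hG) (h.rho μ hμ hG k) = x k :=
  (Classical.choose_spec (h.exists_rho μ hμ hG k)).2

/-- `ρ_k` as a unit. [cite: BihanSottile2008, Thm. 2.2 (proof)] -/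
def rhoU (k : Fin n) : (AdjoinRoot ((X - Polynomial.C (yPt w a b x)) ^ mult w a b B μ x))ˣ :=
  (isUnit_of_truncRes_ne_zero (h.mult_pos μ hμ hG) (h.rho μ hμ hG k) (by
    rw [h.truncRes_rho μ hμ hG]
    exact h.ne_zero k)).unit

/-- `ρ_k` as a unit has value `ρ_k`. [cite: BihanSottile2008, Thm. 2.2 (proof)] -/
private theorem val_rhoU (k : Fin n) : (h.rhoU μ hμ hG k : AdjoinRoot ((X - Polynomial.C (yPt w a b x)) ^ mult w a b B μ x)) = h.rho μ hμ hG k := IsUnit.unit_spec _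

/-- `ρ_k^N = q̄_k` as units. [cite: BihanSottile2008, Thm. 2.2 (proof)] -/
private theorem rhoU_pow (k : Fin n) : h.rhoU μ hμ hG k ^ (bigN w h.ne : ℤ) = h.qU μ hμ hG k := by
  apply Units.ext
  rw [zpow_natCast, Units.val_pow_eq_pow_val, h.val_rhoU μ hμ hG, h.rho_pow μ hμ hG]

/-- The residue of `ρ^u` is `x^u`. [cite: BihanSottile2008, Thm. 2.2 (proof)] -/
private theorem truncRes_umon_rhoU (u : Fin n → ℤ) :
    truncRes (yPt w a b x) (mult w a b B μ x) (h.mult_pos μ hμ hG)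
      (umon (T := AdjoinRoot ((X - Polynomial.C (yPt w a b x)) ^ mult w a b B μ x)) (h.rhoU μ hμ hG) u : AdjoinRoot ((X - Polynomial.C (yPt w a b x)) ^ mult w a b B μ x)) = monomial u x := by
  rw [residue_umon_alg, monomial]
  exact Finset.prod_congr rfl fun k _ => by rw [h.val_rhoU μ hμ hG, h.truncRes_rho μ hμ hG]

/-- `(ρ^u)^N = ∏_k q̄_k^{u_k}`. [cite: BihanSottile2008, Thm. 2.2 (proof)] -/
theorem umon_rhoU_zpow_bigN (u : Fin n → ℤ) :
    umon (T := AdjoinRoot ((X - Polynomial.C (yPt w a b x)) ^ mult w a b B μ x)) (h.rhoU μ hμ hG) u ^ (bigN w h.ne : ℤ) =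
      umon (T := AdjoinRoot ((X - Polynomial.C (yPt w a b x)) ^ mult w a b B μ x)) (fun t => h.truncP μ hμ hG (pairCompl h.ne t))
        (∑ k, u k • fun t => adjCoef w h.ne k t) := by
  rw [umon_sum_zsmul, ← umon_zsmul]
  unfold umon
  refine Finset.prod_congr rfl fun k _ => ?_
  rw [Pi.smul_apply, smul_eq_mul, _root_.zpow_mul, h.rhoU_pow μ hμ hG]
  rfl

/-- **(II)** `ρ^{u_t} = p̄_{e_t}` for the columns `u_t = w_{e_t} − w_a`: both are `N`-th roots of
`p̄_{e_t}^N` with residue `x^{u_t}`. [cite: BihanSottile2008, Thm. 2.2 (proof)] -/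
theorem umon_rhoU_col (t : Fin n) :
    umon (T := AdjoinRoot ((X - Polynomial.C (yPt w a b x)) ^ mult w a b B μ x)) (h.rhoU μ hμ hG) (w (pairCompl h.ne t) - w a) =
      h.truncP μ hμ hG (pairCompl h.ne t) := by
  have hN := bigN_pos w h.ne (det_expDiff_ne_zero w C h.rank h.circuit h.ne)
  have hpowU : umon (T := AdjoinRoot ((X - Polynomial.C (yPt w a b x)) ^ mult w a b B μ x)) (h.rhoU μ hμ hG) (w (pairCompl h.ne t) - w a) ^ (bigN w h.ne : ℤ) =
      h.truncP μ hμ hG (pairCompl h.ne t) ^ (bigN w h.ne : ℤ) := by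
    rw [h.umon_rhoU_zpow_bigN μ hμ hG]
    have hvec : (∑ k, (w (pairCompl h.ne t) - w a) k • fun t' => adjCoef w h.ne k t') =
        fun t' => if t' = t then (bigN w h.ne : ℤ) else 0 := by
      funext t'
      simp only [Finset.sum_apply, Pi.smul_apply, smul_eq_mul]
      exact sum_expDiff_mul_adjCoef w h.ne t t'
    rw [hvec, umon_single]
  apply Units.ext
  refine eq_of_pow_eq_pow_of_residue_alg (truncRes (yPt w a b x) (mult w a b B μ x)
    (h.mult_pos μ hμ hG)) (isUnit_of_truncRes_ne_zero (h.mult_pos μ hμ hG)) hN ?_ ?_ ?_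
  · have := congrArg (fun U : (AdjoinRoot ((X - Polynomial.C (yPt w a b x)) ^ mult w a b B μ x))ˣ => (U : AdjoinRoot ((X - Polynomial.C (yPt w a b x)) ^ mult w a b B μ x))) hpowU
    simpa only [zpow_natCast, Units.val_pow_eq_pow_val] using this
  · rw [h.truncRes_umon_rhoU μ hμ hG, h.truncRes_truncP μ hμ hG]
  · rw [h.truncRes_umon_rhoU μ hμ hG]
    exact (monomial_pos _ h.pos).ne'

/-- **(III)** `ρ^{w_b − w_a} = Ȳ`: `(ρ^v)^N = ∏_t p̄_{e_t}^{c'_t}`, and `∏_t p̄_{e_t}^{c'_t} = Ȳ^N`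
because its `μ_b`-th power is `Ȳ^{N μ_b}` by the affine relation and `g ≡ 1`.
[cite: BihanSottile2008, Thm. 2.2 (proof)] -/
theorem umon_rhoU_v (hμb : μ b ≠ 0) :
    umon (T := AdjoinRoot ((X - Polynomial.C (yPt w a b x)) ^ mult w a b B μ x)) (h.rhoU μ hμ hG) (w b - w a) = h.truncP μ hμ hG b := by
  have hdet := det_expDiff_ne_zero w C h.rank h.circuit h.ne
  have hN := bigN_pos w h.ne hdet
  have hm := h.mult_pos μ hμ hG
  set P : Fin n → (AdjoinRoot ((X - Polynomial.C (yPt w a b x)) ^ mult w a b B μ x))ˣ := fun t => h.truncP μ hμ hG (pairCompl h.ne t) with hP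
  set R : (AdjoinRoot ((X - Polynomial.C (yPt w a b x)) ^ mult w a b B μ x))ˣ := h.truncP μ hμ hG b with hR
  -- `∏_t p̄_{e_t}^{c'_t} = R^N`
  have hz : umon (T := AdjoinRoot ((X - Polynomial.C (yPt w a b x)) ^ mult w a b B μ x)) P (adjCoef' w h.ne) = R ^ (bigN w h.ne : ℤ) := by
    set z : (AdjoinRoot ((X - Polynomial.C (yPt w a b x)) ^ mult w a b B μ x))ˣ := umon (T := AdjoinRoot ((X - Polynomial.C (yPt w a b x)) ^ mult w a b B μ x)) P (adjCoef' w h.ne) * (R ^ (bigN w h.ne : ℤ))⁻¹ with hzdef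
    have hzμ : z ^ μ b = 1 := by
      have h1 : umon (T := AdjoinRoot ((X - Polynomial.C (yPt w a b x)) ^ mult w a b B μ x)) P (adjCoef' w h.ne) ^ μ b = R ^ (μ b * (bigN w h.ne : ℤ)) := by
        rw [← umon_zsmul]
        have hvec : (μ b • adjCoef' w h.ne) = (-(bigN w h.ne : ℤ)) • fun t => μ (pairCompl h.ne t) := by
          funext t
          simp only [Pi.smul_apply, smul_eq_mul]
          rw [mul_adjCoef'_eq w h.ne hdet μ hμ t]
          ring
        rw [hvec, umon_zsmul, hP, h.umon_truncP_rel μ hμ hG, ← hR, ← _root_.zpow_mul]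
        congr 1
        ring
      rw [hzdef, mul_zpow, h1, _root_.inv_zpow', ← _root_.zpow_mul, ← _root_.zpow_add]
      convert zpow_zero R using 2
      ring
    have hzabs := pow_natAbs_eq_one_of_zpow_eq_one z (μ b) hzμ
    have hzres : truncRes (yPt w a b x) (mult w a b B μ x) hm (z : AdjoinRoot ((X - Polynomial.C (yPt w a b x)) ^ mult w a b B μ x)) = 1 := by
      rw [hzdef, Units.val_mul, map_mul, algHom_val_inv, algHom_val_zpow, hP,
        h.truncRes_umon_truncP μ hμ hG, sum_adjCoef'_smul, monomial_zsmul x h.ne_zero, hR,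
        h.truncRes_truncP μ hμ hG, mul_inv_cancel₀]
      exact zpow_ne_zero _ (monomial_pos _ h.pos).ne'
    have hz1 : (z : AdjoinRoot ((X - Polynomial.C (yPt w a b x)) ^ mult w a b B μ x)) = 1 := by
      refine eq_of_pow_eq_pow_of_residue_alg (truncRes (yPt w a b x) (mult w a b B μ x) hm)
        (isUnit_of_truncRes_ne_zero hm) (Int.natAbs_pos.mpr hμb) ?_ ?_ ?_
      · rw [one_pow, ← Units.val_pow_eq_pow_val, hzabs, Units.val_one]
      · rw [hzres, map_one]
      · rw [hzres]; exact one_ne_zero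
    have : z = 1 := Units.ext hz1
    rw [hzdef, mul_inv_eq_one] at this
    exact this
  have hpowU : umon (T := AdjoinRoot ((X - Polynomial.C (yPt w a b x)) ^ mult w a b B μ x)) (h.rhoU μ hμ hG) (w b - w a) ^ (bigN w h.ne : ℤ) =
      R ^ (bigN w h.ne : ℤ) := by
    rw [h.umon_rhoU_zpow_bigN μ hμ hG, ← hz]
    congr 1
    funext t
    simp only [Finset.sum_apply, Pi.smul_apply, smul_eq_mul, adjCoef']
  apply Units.ext
  refine eq_of_pow_eq_pow_of_residue_alg (truncRes (yPt w a b x) (mult w a b B μ x) hm)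
    (isUnit_of_truncRes_ne_zero hm) hN ?_ ?_ ?_
  · have := congrArg (fun U : (AdjoinRoot ((X - Polynomial.C (yPt w a b x)) ^ mult w a b B μ x))ˣ => (U : AdjoinRoot ((X - Polynomial.C (yPt w a b x)) ^ mult w a b B μ x))) hpowU
    simpa only [zpow_natCast, Units.val_pow_eq_pow_val] using this
  · rw [h.truncRes_umon_rhoU μ hμ hG, hR, h.truncRes_truncP μ hμ hG]
  · rw [h.truncRes_umon_rhoU μ hμ hG]
    exact (monomial_pos _ h.pos).ne'

end Psi

end GaleLocalData

namespace GaleLocalData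

variable {n : ℕ} {w : Fin (n + 2) → Fin n → ℤ} {C : Matrix (Fin n) (Fin (n + 2)) ℝ}
  {a b : Fin (n + 2)} {B : Matrix (Fin (n + 2)) (Fin 2) ℝ} {x : Fin n → ℝ}

/-! #### `Ψ : ℝ[X]_{𝔪_x}/(f) → ℝ[Y]/((Y − y₀)^m)`, `X_k ↦ ρ_k`, and the isomorphism -/

section Iso

variable (h : GaleLocalData w C a b B x) (μ : Fin (n + 2) → ℤ) (hμ : (expMatrix w).mulVec μ = 0)
  (hG : galePoly B μ ≠ 0)
include h hμ hG

/-- `Ψ₀ : ℝ[X_1, …, X_n] → ℝ[Y]/((Y − y₀)^m)`, `X_k ↦ ρ_k`. [cite: BihanSottile2008, Thm. 2.2 (proof)] -/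
def psi0 : MvPolynomial (Fin n) ℝ →ₐ[ℝ] AdjoinRoot ((X - Polynomial.C (yPt w a b x)) ^ mult w a b B μ x) :=
  MvPolynomial.aeval fun k => h.rho μ hμ hG k

/-- `Ψ₀` followed by the residue is evaluation at `x`. [cite: BihanSottile2008, Thm. 2.2 (proof)] -/
private theorem truncRes_psi0 (p : MvPolynomial (Fin n) ℝ) :
    truncRes (yPt w a b x) (mult w a b B μ x) (h.mult_pos μ hμ hG) (h.psi0 μ hμ hG p) =
      MvPolynomial.eval x p := by
  rw [psi0, ← AlgHom.comp_apply, MvPolynomial.comp_aeval]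
  have hx : (fun k => truncRes (yPt w a b x) (mult w a b B μ x) (h.mult_pos μ hμ hG)
      (h.rho μ hμ hG k)) = x := funext (h.truncRes_rho μ hμ hG)
  rw [hx]
  rfl

/-- `Ψ₁ : ℝ[X]_{𝔪_x} → ℝ[Y]/((Y − y₀)^m)` (denominators go to units: their residue is their value at
`x`). [cite: BihanSottile2008, Thm. 2.2 (proof)] -/
def psi1 : Localization.AtPrime (pointIdeal x) →ₐ[ℝ] AdjoinRoot ((X - Polynomial.C (yPt w a b x)) ^ mult w a b B μ x) :=
  IsLocalization.liftAlgHom (M := (pointIdeal x).primeCompl) (f := h.psi0 μ hμ hG) (fun s =>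
    isUnit_of_truncRes_ne_zero (h.mult_pos μ hμ hG) _ (by
      rw [truncRes_psi0]
      exact fun h0 => s.2 ((mem_pointIdeal_iff x _).mpr h0)))

/-- `Ψ₁` extends `Ψ₀`. [cite: BihanSottile2008, Thm. 2.2 (proof)] -/
private theorem psi1_algebraMap (p : MvPolynomial (Fin n) ℝ) :
    h.psi1 μ hμ hG (algebraMap _ (Localization.AtPrime (pointIdeal x)) p) = h.psi0 μ hμ hG p := by
  rw [psi1, IsLocalization.liftAlgHom_apply, IsLocalization.lift_eq]
  rfl

/-- `Ψ₁(X_k) = ρ_k`. [cite: BihanSottile2008, Thm. 2.2 (proof)] -/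
private theorem psi1_locXUnit (k : Fin n) :
    h.psi1 μ hμ hG (locXUnit x h.ne_zero k : Localization.AtPrime (pointIdeal x)) = h.rho μ hμ hG k := by
  rw [val_locXUnit, psi1_algebraMap, psi0, MvPolynomial.aeval_X]

/-- `Ψ₁(X^u) = ρ^u`. [cite: BihanSottile2008, Thm. 2.2 (proof)] -/
private theorem psi1_locMon (u : Fin n → ℤ) :
    h.psi1 μ hμ hG (locMon x h.ne_zero u : Localization.AtPrime (pointIdeal x)) = (umon (T := AdjoinRoot ((X - Polynomial.C (yPt w a b x)) ^ mult w a b B μ x)) (h.rhoU μ hμ hG) u : AdjoinRoot ((X - Polynomial.C (yPt w a b x)) ^ mult w a b B μ x)) :=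
  map_val_umon (T' := AdjoinRoot ((X - Polynomial.C (yPt w a b x)) ^ mult w a b B μ x)) (h.psi1 μ hμ hG).toRingHom (locXUnit x h.ne_zero) (h.rhoU μ hμ hG)
    (fun k => by rw [h.val_rhoU μ hμ hG]; exact (h.psi1_locXUnit μ hμ hG k).symm) u

/-- `ρ^{w_ℓ − w_a} = p̄_ℓ` for EVERY `ℓ` (cases `ℓ = a`, `ℓ = b` (III), `ℓ = e_t` (II)).
[cite: BihanSottile2008, Thm. 2.2 (proof)] -/
theorem umon_rhoU_sub (hμb : μ b ≠ 0) (ℓ : Fin (n + 2)) :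
    (umon (T := AdjoinRoot ((X - Polynomial.C (yPt w a b x)) ^ mult w a b B μ x)) (h.rhoU μ hμ hG) (w ℓ - w a) : AdjoinRoot ((X - Polynomial.C (yPt w a b x)) ^ mult w a b B μ x)) = AdjoinRoot.mk _ (linPoly B ℓ) := by
  rcases eq_or_eq_or_exists_pairCompl h.ne ℓ with rfl | rfl | ⟨t, rfl⟩
  · rw [sub_self, umon_zero, Units.val_one, linPoly_left h.basis, map_one]
  · rw [h.umon_rhoU_v μ hμ hG hμb, val_truncP]
  · rw [h.umon_rhoU_col μ hμ hG t, val_truncP]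

/-- **`Ψ₁` kills the generators `h_ℓ`** (hence the local ideal `(f)`).
[cite: BihanSottile2008, Thm. 2.2 (proof)] -/
theorem psi1_hgen (hμb : μ b ≠ 0) (ℓ : Fin (n + 2)) :
    h.psi1 μ hμ hG (hgen w B a b x h.ne_zero ℓ) = 0 := by
  have key : ∀ ℓ', h.psi1 μ hμ hG (locMon x h.ne_zero (w ℓ') : Localization.AtPrime (pointIdeal x)) =
      AdjoinRoot.mk _ (linPoly B ℓ') * (umon (T := AdjoinRoot ((X - Polynomial.C (yPt w a b x)) ^ mult w a b B μ x)) (h.rhoU μ hμ hG) (w a) : AdjoinRoot ((X - Polynomial.C (yPt w a b x)) ^ mult w a b B μ x)) := by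
    intro ℓ'
    have e : locMon x h.ne_zero (w ℓ') = locMon x h.ne_zero (w ℓ' - w a) * locMon x h.ne_zero (w a) := by
      rw [locMon, locMon, locMon, ← umon_add, sub_add_cancel]
    rw [e, Units.val_mul, map_mul, psi1_locMon, psi1_locMon, h.umon_rhoU_sub μ hμ hG hμb]
  rw [hgen, map_sub, map_sub, map_smul, map_smul, key, key, key, linPoly_left h.basis,
    linPoly_right h.basis, map_one, AdjoinRoot.mk_X, linPoly, map_add, map_mul, AdjoinRoot.mk_C,
    AdjoinRoot.mk_C, AdjoinRoot.mk_X, Algebra.smul_def, Algebra.smul_def, AdjoinRoot.algebraMap_eq]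
  ring

/-- `Ψ : ℝ[X]_{𝔪_x}/(f) → ℝ[Y]/((Y − y₀)^m)`. [cite: BihanSottile2008, Thm. 2.2 (proof)] -/
def psi (hμb : μ b ≠ 0) : (Localization.AtPrime (pointIdeal x) ⧸ locIdeal w C x) →ₐ[ℝ] AdjoinRoot ((X - Polynomial.C (yPt w a b x)) ^ mult w a b B μ x) :=
  Ideal.Quotient.liftₐ (locIdeal w C x) (h.psi1 μ hμ hG) (fun _ ho =>
    map_systemIdeal_le_ker h.basis x h.ne_zero (h.psi1 μ hμ hG) (h.psi1_hgen μ hμ hG hμb) ho)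

/-- `Ψ` on classes is `Ψ₁`. [cite: BihanSottile2008, Thm. 2.2 (proof)] -/
private theorem psi_mk (hμb : μ b ≠ 0) (o : Localization.AtPrime (pointIdeal x)) :
    h.psi μ hμ hG hμb (Ideal.Quotient.mk _ o) = h.psi1 μ hμ hG o := by
  rw [psi, Ideal.Quotient.liftₐ_apply, Ideal.Quotient.lift_mk]
  rfl

/-- `Ψ ∘ Φ = id` (check on `Ȳ`: `Ψ(X^{w_b − w_a}) = ρ^{w_b − w_a} = Ȳ` by (III)).
[cite: BihanSottile2008, Thm. 2.2 (proof)] -/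
theorem psi_comp_phi (hμb : μ b ≠ 0) :
    (h.psi μ hμ hG hμb).comp (h.phi μ hμ hG) = AlgHom.id ℝ (AdjoinRoot ((X - Polynomial.C (yPt w a b x)) ^ mult w a b B μ x)) := by
  apply AdjoinRoot.algHom_ext
  rw [AlgHom.comp_apply, phi_root, psi_mk, psi1_locMon, h.umon_rhoU_v μ hμ hG hμb,
    val_truncP_right, AlgHom.id_apply]

/-- `Φ ∘ Ψ = id` (check on `X_k`: `Φ(ρ_k)` and `X_k` are `N`-th roots of `X^{N e_k}` with residue
`x_k`). [cite: BihanSottile2008, Thm. 2.2 (proof)] -/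
theorem phi_comp_psi (hμb : μ b ≠ 0) :
    (h.phi μ hμ hG).comp (h.psi μ hμ hG hμb) = AlgHom.id ℝ (Localization.AtPrime (pointIdeal x) ⧸ locIdeal w C x) := by
  have hN := bigN_pos w h.ne (det_expDiff_ne_zero w C h.rank h.circuit h.ne)
  apply Ideal.Quotient.algHom_ext
  apply IsLocalization.algHom_ext (pointIdeal x).primeCompl
  apply MvPolynomial.algHom_ext
  intro k
  have hXk : (Algebra.algHom ℝ (MvPolynomial (Fin n) ℝ) (Localization.AtPrime (pointIdeal x))) (MvPolynomial.X k) =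
      (locXUnit x h.ne_zero k : Localization.AtPrime (pointIdeal x)) := by
    rw [val_locXUnit]
    rfl
  simp only [AlgHom.comp_apply, AlgHom.id_apply, Ideal.Quotient.mkₐ_eq_mk, hXk]
  rw [psi_mk, psi1_locXUnit]
  -- `Φ(ρ_k) = X̄_k`
  set α : Localization.AtPrime (pointIdeal x) ⧸ locIdeal w C x := h.phi μ hμ hG (h.rho μ hμ hG k) with hα
  have hβ : Ideal.Quotient.mk (locIdeal w C x) (locXUnit x h.ne_zero k : Localization.AtPrime (pointIdeal x)) = (h.quotX k : Localization.AtPrime (pointIdeal x) ⧸ locIdeal w C x) := rfl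
  rw [hβ]
  have hpow : α ^ bigN w h.ne = ((h.quotX k : (Localization.AtPrime (pointIdeal x) ⧸ locIdeal w C x)ˣ) : Localization.AtPrime (pointIdeal x) ⧸ locIdeal w C x) ^ bigN w h.ne := by
    rw [hα, ← map_pow, rho_pow]
    -- `Φ(q̄_k) = X̄^{∑_t c_{k,t} u_t} = X̄_k^N`
    have hmap : h.phi μ hμ hG (h.qU μ hμ hG k : AdjoinRoot ((X - Polynomial.C (yPt w a b x)) ^ mult w a b B μ x)) =
        ((umon (T := Localization.AtPrime (pointIdeal x) ⧸ locIdeal w C x) (fun t => umon (T := Localization.AtPrime (pointIdeal x) ⧸ locIdeal w C x) h.quotX (w (pairCompl h.ne t) - w a))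
          (fun t => adjCoef w h.ne k t) : (Localization.AtPrime (pointIdeal x) ⧸ locIdeal w C x)ˣ) : Localization.AtPrime (pointIdeal x) ⧸ locIdeal w C x) :=
      map_val_umon (T' := Localization.AtPrime (pointIdeal x) ⧸ locIdeal w C x) (h.phi μ hμ hG).toRingHom
        (fun t => h.truncP μ hμ hG (pairCompl h.ne t))
        (fun t => umon (T := Localization.AtPrime (pointIdeal x) ⧸ locIdeal w C x) h.quotX (w (pairCompl h.ne t) - w a))
        (fun t => by
          rw [← mk_aeval_linPoly, val_truncP]
          exact (h.phi_mk μ hμ hG _).symm) _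
    rw [hmap]
    have hinner : umon (T := Localization.AtPrime (pointIdeal x) ⧸ locIdeal w C x) (fun t => umon (T := Localization.AtPrime (pointIdeal x) ⧸ locIdeal w C x) h.quotX (w (pairCompl h.ne t) - w a))
        (fun t => adjCoef w h.ne k t) =
        umon (T := Localization.AtPrime (pointIdeal x) ⧸ locIdeal w C x) h.quotX (∑ t, adjCoef w h.ne k t • (w (pairCompl h.ne t) - w a)) := by
      rw [umon_sum_zsmul]
      rfl
    rw [hinner, sum_adjCoef_smul, umon_single, zpow_natCast, Units.val_pow_eq_pow_val]
  refine eq_of_pow_eq_pow_of_residue_alg h.quotEval h.isUnit_of_quotEval_ne_zero hN hpow ?_ ?_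
  · rw [hα, ← AlgHom.comp_apply, quotEval_comp_phi, truncRes_rho]
    change x k = h.quotEval (Ideal.Quotient.mk (locIdeal w C x) (locXUnit x h.ne_zero k : Localization.AtPrime (pointIdeal x)))
    rw [quotEval_mk, locEval_locXUnit]
  · rw [hα, ← AlgHom.comp_apply, quotEval_comp_phi, truncRes_rho]
    exact h.ne_zero k

/-- **The local algebra is `ℝ[Y]/((Y − y₀)^m)`.** [cite: BihanSottile2008, Thm. 2.2] -/
def localAlgEquiv (hμb : μ b ≠ 0) : (AdjoinRoot ((X - Polynomial.C (yPt w a b x)) ^ mult w a b B μ x)) ≃ₐ[ℝ] (Localization.AtPrime (pointIdeal x) ⧸ locIdeal w C x) :=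
  AlgEquiv.ofAlgHom (h.phi μ hμ hG) (h.psi μ hμ hG hμb) (h.phi_comp_psi μ hμ hG hμb)
    (h.psi_comp_phi μ hμ hG hμb)

/-- `dim_ℝ ℝ[X]_{𝔪_x}/(f) = m`. [cite: BihanSottile2008, Thm. 2.2] -/
theorem finrank_eq_mult (hμb : μ b ≠ 0) : Module.finrank ℝ (Localization.AtPrime (pointIdeal x) ⧸ locIdeal w C x) = mult w a b B μ x := by
  rw [← (h.localAlgEquiv μ hμ hG hμb).toLinearEquiv.finrank_eq, finrank_trunc]

/-- **Multiplicities are preserved by the Gale correspondence** (bundled form): the intersection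
multiplicity of the positive solution `x` equals the multiplicity of `y₀ = x^{w_b − w_a}` as a root of
`∏ p_ℓ^{μ⁺} − ∏ p_ℓ^{μ⁻}`. [cite: BihanSottile2008, Thm. 2.2; BihanDickenstein2017, §4.2
("this bijection … preserves the multiplicities [BS08]")] -/
theorem solMultiplicity_eq (hμb : μ b ≠ 0) :
    solMultiplicity w C x = (galePoly B μ).rootMultiplicity (monomial (w b - w a) x) := by
  rw [solMultiplicity_eq_finrank, h.finrank_eq_mult μ hμ hG hμb]
  rfl

end Iso

end GaleLocalData

/-! ### The multiplicity theorem, unbundled -/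

/-- **Bihan–Sottile 2008, Thm. 2.2 (local form at a positive point), as used in BD 2017 §4.2**:
for a circuit `𝒜` with `A`, `C` of ranks `n + 1`, `n`, indices `a ≠ b` with `det C(a, b) ≠ 0`, the
normalized Gale basis `P^j, P^i` at `(a, b)` (`P_a = (1,0)`, `P_b = (0,1)`), an integer affine
relation `μ` (`A μ = 0`, `μ_b ≠ 0`; e.g. `λ` or `λ̃`) and a positive solution `x` of (1.1): the
multiplicity of `x` (`dim_ℝ ℝ[X]_{𝔪_x}/(f_1, …, f_n)`) equals the multiplicity of `y₀ = x^{w_b − w_a}`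
as a root of the polynomial `∏_{μ_ℓ>0} p_ℓ^{μ_ℓ} − ∏_{μ_ℓ<0} p_ℓ^{−μ_ℓ}` (assumed nonzero, i.e.
`g ≢ 1`): "this bijection `x ↦ y = x^{w_{ᾱ_j}}` between positive solutions of (1.1) and solutions of
`g(y) = 1` in `Δ_P` preserves the multiplicities [BS08]" (p0011:L56–57).
[cite: BihanDickenstein2017, §4.2 (proof of Thm. 2.9); BihanSottile2008, Thm. 2.2 and §3] -/
theorem solMultiplicity_eq_rootMultiplicity {n : ℕ} (w : Fin (n + 2) → Fin n → ℤ)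
    (C : Matrix (Fin n) (Fin (n + 2)) ℝ) (hrk : RankCond w C) (hcirc : IsCircuit w)
    {a b : Fin (n + 2)} (hab : a ≠ b) (hmin : coeffMinor C a b ≠ 0)
    {B : Matrix (Fin (n + 2)) (Fin 2) ℝ} (hB : IsNormalizedGaleBasis C a b B)
    (μ : Fin (n + 2) → ℤ) (hμ : (expMatrix w).mulVec μ = 0) (hμb : μ b ≠ 0)
    {x : Fin n → ℝ} (hx : x ∈ posSolutions w C) (hG : galePoly B μ ≠ 0) :
    solMultiplicity w C x = (galePoly B μ).rootMultiplicity (monomial (w b - w a) x) :=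
  (GaleLocalData.mk hrk hcirc hab hmin hB hx).solMultiplicity_eq μ hμ hG hμb

/-- The same with the affine relation `λ` of (2.1) (`A λ = 0`, and `λ_b ≠ 0` for a circuit).
[cite: BihanDickenstein2017, §4.2 (proof of Thm. 2.9); BihanSottile2008, Thm. 2.2] -/
theorem solMultiplicity_eq_rootMultiplicity_affRel {n : ℕ} (w : Fin (n + 2) → Fin n → ℤ)
    (C : Matrix (Fin n) (Fin (n + 2)) ℝ) (hrk : RankCond w C) (hcirc : IsCircuit w)
    {a b : Fin (n + 2)} (hab : a ≠ b) (hmin : coeffMinor C a b ≠ 0)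
    {B : Matrix (Fin (n + 2)) (Fin 2) ℝ} (hB : IsNormalizedGaleBasis C a b B)
    {x : Fin n → ℝ} (hx : x ∈ posSolutions w C) (hG : galePoly B (affRel w) ≠ 0) :
    solMultiplicity w C x = (galePoly B (affRel w)).rootMultiplicity (monomial (w b - w a) x) :=
  solMultiplicity_eq_rootMultiplicity w C hrk hcirc hab hmin hB (affRel w)
    (expMatrix_mulVec_affRel w) (hcirc b) hx hG

end BD17

end Literature.Computability.AlgebraicComplexity
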